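/-
Copyright: lit-balaban Phase-2 proof seat p34 (gen 16).  Statement-level skeleton of a published paper; no proof claims beyond what the
kernel checks below.
-/
import Literature.MathematicalPhysics.QuantumFieldTheory.BalabanImbrieJaffe1984to88.BIJ85ScalarPropagatorSupDecay

/-!
# [BalabanImbrieJaffe1988] §2 p. 262–263, (2.27)/(2.28)/(2.30) — **THE REGION NEUMANN PROPAGATORS `G_k(Ω,u)` AT NON-FLAT SMALL FIELDS:
# COERCIVITY OF THE NEUMANN FORM ON `Ω`-SUPPORTED FIELDS, THE WEIGHTED `ℓ²` (AGMON) BOUND, AND THE `k`-UNIFORM KERNEL DECAY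
# `|G_k(Ω,u; x, y)| ≤ c₀(L^kε)²e^{−t₀|x−y|_∞/L^k}` FOR EVERY UNION `Ω` OF `k`-BLOCKS** — hence the kernel decay of (2.27) `G̃_k(u)` and
# (2.28) `G_{k,loc}(u)` at non-flat `u` (the `|G(x,y)| ≤ Ae^{−c·dist}` input shape of p02's (2.30) hence-step `BIJ88OpDecay230Proof`);
# v1.1 (§7): THE WEIGHTED ENERGY BOUND AND THE COVARIANT-DERIVATIVE MEMBER `|(D_uG_k(Ω,u)δ_y)(b)| ≤ c₁(L^kε)e^{−t₀|y−b₊|_∞/L^k}`;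
# v1.2 (§8): THE COVARIANT-DERIVATIVE MEMBER FOR (2.27) `G̃_k(u)` AND (2.28) `G_{k,loc}(u)` (weights and cut-off moved through `D_u`)

T. Bałaban, J. Imbrie, A. Jaffe, *Effective action and cluster properties of the abelian Higgs model*, Commun. Math. Phys. **114** (1988)
257–315 [BalabanImbrieJaffe1988], Sect. 2 p. 262–263 [PDF 6–7], (2.27)–(2.30); [I] = T. Bałaban, J. Imbrie, A. Jaffe, *Renormalization of
the Higgs model: minimizers, propagators and the stability of mean field theory*, Commun. Math. Phys. **97** (1985) 299–329
[BalabanImbrieJaffe1985], §7.3 p. 326 [PDF 28], (4.6.2)–(4.6.3) p. 313 [PDF 15]; [6] = [7] of [I] = [Balaban1983RegularityDecay],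
Commun. Math. Phys. **89** (1983) 571–597, (1.10) p. 573.

statement-level skeleton of published theorems with citation tags; proofs where landed; nothing here is a claim about the Yang–Mills mass gap

PDF held: `paper:balaban1988-cmp114-bij-abelian-higgs-effective-action` (journal page = PDF page + 256), p. 262–263 [PDF 6–7];
`paper:balaban1985-cmp97-bij-higgs-minimizers` (journal page = PDF page + 298), p. 326 [PDF 28], p. 313 [PDF 15].

CITATION HEADER (lean-in-tree rule).  Part of the lit-balaban TYPED SKELETON (HOME `run/shared/lean/pub/lit-balaban/`), PHASE-2 proof seat
p34 gen 16 (unit `lit-balaban-p34-g16`; TAKING line HOME/STATUS.md 2026-08-22T23:12:49Z; free-target protocol G.5-34(d) — sources: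
the owner's `HOME/lit-balaban-r15/C1-CLOSURE.md` §5 item 3 residual *"the REGION form G_k(Ω, u_k)"* at non-flat `u` (its whole-torus
member is p27 g32's `BIJ85ScalarPropagatorSupDecay.decay110_smallField`), the p31 HANDOFF (gen 19) successor item (a) *"[6] … at small
non-flat A for the torus cube propagators"*, and `HOME/lit-balaban-r18/C2S14-CLOSURE.md` §5 item 2 (ii), non-flat case).  WHAT IS
REPRODUCED: located members of rows **C2.Eq2.30** (the `[6]`-input *"|(G_{k,loc}(u)f)(x)| ≦ ce^{−c dist(suppt f,x)}‖f‖_∞"* in KERNEL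
form), **C2.Eq2.27**, **C2.Eq2.28** (`HOME/lit-balaban-r18/ROWS-C2.md`, owner r18) for gen 15's torus objects of record `gBox`/`gTilde`/`gLocT`
AT NON-FLAT SMALL FIELDS, and of row **C1.Eq7.3.1-7.3.2** (`HOME/lit-balaban-r15/ROWS-C1.md`, owner r15: the p. 326 sentence *"The
propagators arising from Δ_k(u_k), under the restriction (7.3.1) on the gauge field, also satisfy the regularity and decay estimates of
[7]"*, here for the REGION propagators `G_k(Λ,u)`).  No head changes; the decls of record of the displays stay r18's one-letter shapes and p02's
hence-steps.  Kind «model-level theorems only» (no new definition, no `Prop`-valued fact introduced).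

THE PRINTED TEXT (verbatim).  C2 p. 262–263 [PDF 6–7]: *"In the scalar field sector, we have the η-lattice propagators G_k(Ω,u) defined on
subsets Ω ⊂ T_η with Neumann boundary conditions. To localize the dependence on u, we interpolate in a smooth fashion between operators with
Neumann boundary conditions on small cubes. … Define G̃_k(u;x₁,x₂) = Σ_α λ_αG_k(□_α,u;x₁,x₂) (2.27) as a convex combination of Neumann
propagators. … We then put G_{k,loc}(u;x₁,x₂) = ζ″_k(x₁,x₂)G̃_k(u;x₁,x₂), (2.28) … a straightforward application of the random walk expansion
of [6] shows that |(G_{k,loc}(u)f)(x)| ≦ ce^{−c dist(suppt f,x)}‖f‖_∞, (2.30) … We assume that u is smooth in the □_α's entering the sum in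
(2.27)"*.  [I] p. 326 [PDF 28]: *"In this section we use smallness of the gauge field (7.2.4) to prove (7.2.5) and to establish estimates for
G_k(Λ₃, u). … These inequalities can be proved by an extension of the proofs of [7]. The propagators arising from Δ_k(u_k), under the
restriction (7.3.1) on the gauge field, also satisfy the regularity and decay estimates of [7]. In order to remain within the framework of
this reference, we remark that by change of gauge u_k can be transformed in a local region Λ into a configuration of the form exp[ie_kηA],
where A is smooth and small."*  [6] (1.10) p. 573 (as transcribed in the tree's `Balaban1983to89.B4Thm110ZeroTorus`): *"|(D^η_{A,μ}G_k(Ω,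
A)f)(x)|, |(G_k(Ω, A)f)(x)| ≤ c₀exp(−δ₀ dist(x, supp f))‖f‖_∞ (1.10)"*.

THE OBJECTS (all with bodies, gen 15 = p31 `BIJ88NeumannPropagator227Torus` / `BIJ88DeltaLoc234Torus`).  For a finite union `Ω ⊂ T^{(j)}`
of `k`-blocks (`IsBlockUnion k Ω`): the Neumann-cut covariant derivative `χ_ΩD_u = dN c U Ω` (rows = the bonds `b ∈ Ω*` of r18's
`starB Ω`), the restricted `k`-level covariant average `Q_k(u)|_Ω = qMatK U k Ω` (rows = the blocks `B^k(y) ⊆ Ω`, `innerK k Ω`), the operator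
`nOp a c U k Ω = (χ_ΩD_u)ᴴ(χ_ΩD_u) + a·(Q_k|_Ω)ᴴ(Q_k|_Ω)` and **`G_k(Ω,u) = gBox a c U k Ω`**, the inverse of `nOp` on `ℓ²(Ω)` extended by
`0`; at the parameters of record `c = ε⁻¹`, `a = α_kL^{kd}` (`α_k = a_k(L^kε)^{−2}`, pv07's `B1RG242Torus.α`; counting normalization) this
is [I]'s `G_k(Λ,u)` of (4.6.2) with Neumann conditions on `Λ = Ω` and, for `Ω = □_α` a cube, the `G_k(□_α,u)` of (2.27); `G̃_k(u) =
gTilde`, `G_{k,loc}(u) = gLocT` over a finite family of such regions with real weights `λ_α(x₁,x₂)` and cut-off `ζ″(x₁,x₂)` as data.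

THE SMALLNESS OF THE FIELD (p. 326 *"exp[ie_kηA], where A is smooth and small"*; p. 263 *"u is smooth in the □_α's"*) is the BONDWISE
form INSIDE `Ω` of p33's `BIJ85BlockKPoincare.sum_norm_sq_le_cov` (the coercivity input of p31's non-flat (2.41) files): `|u_b − 1| ≤ T` for
the bonds of `Ω*` with both ends in one `k`-block and `|u(Γ^{(k)}_{x_k,x}) − 1| ≤ δ` for `x ∈ Ω` (`holCK`), with `2(L^k−1)L^k·d·T² + 2δ² ≤
1/2`.  By the gauge covariance `G_k(Ω,u^h) = M_hG_k(Ω,u)M_hᴴ` (gen 15 `gBox_gaugeAct`) the kernel bound holds verbatim at every gauge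
transform of such a field (§5) — e.g. at the [I] (4.5.4) backgrounds `Q^{s*}_kv·e^{iθ}` of p33's `BIJ85Ineq732Background.bg454`.

THE MECHANISM (DIVERGENCE OF METHOD from the printed route — [6]'s random-walk expansion — disclosed, as in p27's whole-torus file; same
SHAPE of statement in KERNEL form).  (§1) The sesquilinear form of the Neumann operator on the region,
`ψᴴ(nOp φ) = Σ_{b∈Ω*} conj(D_uψ)(b)(D_uφ)(b) + aΣ_{B^k(y)⊆Ω} conj(Q_k(u)ψ)(y)(Q_k(u)φ)(y)`, and the equation `nOp(G_k(Ω,u)f) = 1_Ωf`,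
`supp G_k(Ω,u)f ⊆ Ω`.  (§2) COERCIVITY ON `Ω`-SUPPORTED FIELDS: p33's `k`-block Poincaré inequality with centre `(Q_k(u)χ)(y)`
(`sum_norm_sub_sq_le`, `sum_sub_qCovK_eq`) applied ONLY to the blocks `B^k(y) ⊆ Ω` — every in-block bond there lies in `Ω*` and every site
in `Ω` — gives `(1 − 2(n−1)nd·T² − 2δ²)Σ|χ|² ≤ 2(n−1)nΣ_{b∈Ω*}|u_bχ(b₊) − χ(b₋)|² + 2NΣ_{B^k(y)⊆Ω}|(Q_k(u)χ)(y)|²` (`n = L^k`, `N =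
L^{kd}`) for `χ` supported in `Ω`, whence `m₁Σ|χ|² ≤ Re χᴴ(nOp χ)`, `m₁ = min(c²/(4n²), a/(4N))` (the whole-torus inequalities of p11/p33,
whose bond sums run over ALL bonds, are not usable here: a field supported in `Ω` pays `|χ(b₋)|²` on every bond leaving `Ω`).  (§3) THE
AGMON–COMBES–THOMAS BOUND for `G_k(Ω,u)`: for a positive weight `ω` with `(ω(b₊) − ω(b₋))² ≤ S₁ω(b₊)ω(b₋)` on `Ω*` and `(ω(x) − ω(x′))² ≤
S₂ω(x)ω(x′)` inside `k`-blocks, `‖ωG_k(Ω,u)f‖₂ ≤ ‖ωf‖₂/(m₁ − κ)`, `κ = dc²S₁ + aS₂/(2N)` — coercivity at `ωφ`, the two conjugation defects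
(bondwise `|pa − qb|² − Re[conj(p²a − q²b)(a − b)] = (p − q)²Re(āb)`; blockwise, by symmetrization, `−½ΣΣ(ω_x − ω_{x′})²Re(ā_xa_{x′})`),
the equation tested against `ω²φ`, Cauchy–Schwarz (p33's five lines of `BIJ85ScalarPropagatorDecay.agmon_weighted`, here for the REGION
operator in matrix language).  (§4) With `ω = e^{t|y−·|_∞/L^k}` (p27's `weight_bond_osc`; block oscillation `t²e^t`), `c = ε⁻¹`, `a =
α_kL^{kd}`: `m₁ ≥ μ₁/(L^kε)²`, `μ₁ = min(1/4, a/8)` (`a/2 ≤ a_k`), `κ ≤ (d + a/2)e·t/(L^kε)²` for `t ≤ 1`, so for `t₀ = min(1,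
μ₁/((2d + a)e))` the source `f = δ_y` gives **`|G_k(Ω,u;x,y)| ≤ (2/μ₁)(L^kε)²e^{−t₀|x−y|_∞/L^k}`** — `k`-uniform, for EVERY union `Ω` of
`k`-blocks (the whole torus, the cubes `□_α` of (2.27), the regions `Λ` of [I] §7.3).  (§5) Gauge covariance; (§6) the convex combinations
(2.27)/(2.28) over any finite family of block unions, `Σ_α|λ_α| ≤ 1`, `|ζ″| ≤ 1`.  (§7, v1.1) THE COVARIANT-DERIVATIVE MEMBER of [6]
(1.10) (p. 263: *"Bounds analogous to (2.30), (2.31) hold for covariant derivatives … of G_{k,loc}(u)"*) in KERNEL form: the form at the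
weighted field is bounded by the pairing plus the two defects (`Σ_{Ω*}|D_u(ωφ)|² + aΣ|Q_k(u)(ωφ)|² ≤ √A√B + κA`, `A = ‖ωφ‖₂²`, `B = ‖ωf‖₂²`),
whence the weighted ENERGY bound `Σ_{b∈Ω*}|(D_u(ωG_k(Ω,u)f))(b)|² ≤ m₁‖ωf‖₂²/(m₁ − κ)²`; moving the weight through `D_u`
(`ω(b₊)(D_uφ)(b) = (D_u(ωφ))(b) − c(ω(b₊) − ω(b₋))φ(b₋)`, `c = ε⁻¹`, `(ω(b₊) − ω(b₋))² ≤ (t/L^k)²e^{t/L^k}ω(b₊)ω(b₋)`) at `f = δ_y` gives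
**`|(D_uG_k(Ω,u)δ_y)(b)| ≤ c₁(L^kε)e^{−t₀|y−b₊|_∞/L^k}`**, `c₁ = √(2 + 8e²)/μ₁`, for every bond `b ∈ Ω*` — one power of `L^kε` better than
the value member, as in print's scaling.  (§8, v1.2) THE SAME FOR (2.27)/(2.28): a real weight in the output point moves through `D_u` as
`(D_u(λφ))(b) = λ(b₊)(D_uφ)(b) + c(λ(b₊) − λ(b₋))φ(b₋)`; for weights `λ_α(·,y)` supported in the bond interior of `□_α` (zero at both ends of
every bond not in `□_α*` — a support condition of the type of p29's row hypothesis (ii) `BIJ88LocWeights227Torus.rowHyp_ii`, not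
discharged here) and smooth at the bond scale
(`Σ_α|λ_α(b₊,y) − λ_α(b₋,y)| ≤ ℓ`), and a cut-off `|ζ″| ≤ 1` with `|ζ″(b₊,y) − ζ″(b₋,y)| ≤ ℓ′`, §7 (bonds of `□_α*`) and §4/§6 (values) give
**`‖(D_uG̃_k(u)(·,y))(b)‖ ≤ (c₁(L^kε) + c₂ℓε⁻¹(L^kε)²)e^{−t₀|y−b₊|_∞/L^k}`** and **`‖(D_uG_{k,loc}(u)(·,y))(b)‖ ≤ (c₁(L^kε) +
c₂(ℓ + ℓ′)ε⁻¹(L^kε)²)e^{−t₀|y−b₊|_∞/L^k}`** for EVERY bond `b` of the torus.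

WHAT IS PROVED (theorems only; 0 `sorry`; standard axioms; no new definition, no `Prop`-valued fact).
* §1 `star_dotProduct_gram_mulVec`, **`form_nOp_eq`**, `re_form_nOp_self`, `gBox_mulVec_eq_zero_of_not_mem`, `nOp_mulVec_gBox_mulVec`.
* §2 **`coercive_region_poincare`** (the `k`-block Poincaré inequality restricted to `Ω`), **`coercive_region`** (`m₁Σ|χ|² ≤ Re χᴴ(nOp χ)`).
* §3 (private) `bond_defect_le`, `block_defect_le`; `defectD_region_le`, `defectQ_region_le` (the two conjugation defects on the region);
  **`agmon_weighted_region`**.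
* §4 `abs_supDist_tgt_sub_src_le`, `weight_bond_osc_sq`, `weight_block_osc_sq`, `agmon_gap_region`, **`decay_kernel_smallField_region`** (`∃ t₀ c₀ > 0` depending on `d, a` only: for every
  volume with `P.d = d`, every `1 ≤ k ≤ m + K`, every union `Ω` of `k`-blocks, every `U(1)` field with the bondwise smallness `(T, δ)`
  inside `Ω`, all `x, y`: `‖G_k(Ω,u)(x,y)‖ ≤ c₀(L^kε)²e^{−t₀|x−y|_∞/L^k}`), **`decay_ell2_smallField_region`** (the `ℓ²`-source form
  `‖(G_k(Ω,u)f)(x)‖ ≤ c₀(L^kε)²(Σ_z e^{−2t₀|x−z|_∞/L^k}‖f(z)‖²)^{1/2}`).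
* §5 **`decay_kernel_smallField_region_gaugeAct`** (the same for `u^h`, every gauge transformation `h`).
* §6 **`decay_gTilde_smallField_kernel`**, **`decay_gLocT_smallField_kernel`** ((2.27)/(2.28) at non-flat `u`, any finite family of
  block unions, `Σ_α|λ_α(x₁,x₂)| ≤ 1`, `|ζ″| ≤ 1`).
* §7 (v1.1, append-only) `form_weighted_le`, **`energy_weighted_region`** (the weighted energy bound), `weight_covD_sq_le`,
  (private) `weight_tgt_le_exp_mul_src`, `deriv_pieces_arith`, `osc_piece_arith`, `covD_member_arith`, `le_mul_exp_neg_of`;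
  **`decay_covD_kernel_smallField_region`** (`∃ t₀ c₁ > 0` depending on `d, a` only: at the data of `decay_kernel_smallField_region`, for
  every bond `b ∈ Ω*` and every `y`: `‖ε⁻¹(u_bG_k(Ω,u;b₊,y) − G_k(Ω,u;b₋,y))‖ ≤ c₁(L^kε)e^{−t₀|y−b₊|_∞/L^k}`).
* §8 (v1.2, append-only) `covD_sum`, **`covD_weight_mul`**, `norm_covD_weight_mul_le`, (private) `norm_covD_weight_mul_le_of`,
  `exp_neg_src_le_exp_one_mul`, `exp_neg_rate_mono`; **`decay_covD_gTilde_smallField_kernel`**, **`decay_covD_gLocT_smallField_kernel`**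
  (`∃ t₀ c₁ c₂ > 0` depending on `d, a` only: for every finite family of `k`-block unions, weights `Σ_α|λ_α| ≤ 1` supported in the bond
  interiors and `ℓ`-smooth in the output point, cut-off `|ζ″| ≤ 1` `ℓ′`-smooth, every `U(1)` field bondwise small in the `k`-blocks, every
  bond `b` and every `y`: the two displayed bounds above).

HONEST SCOPE.  (i) KERNEL (and `ℓ²`-source) form only: the printed `‖f‖_∞` right-hand side of (1.10)/(2.30) follows with the row sum
`Σ_y e^{−t₀|x−y|_∞/L^k} ≤ K_tL^{kd}`, which is NOT `k`-uniform at this kernel size — the `k`-uniform sup-norm member needs the free tilted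
row bound of p27's route (`BIJ85FreeResolventTiltedRow`, whole torus, `d ≤ 3`) on the region, not done here; the kernel size `c₀(L^kε)²` is
the one of p27's `decay110_smallField_kernel` (no short-distance gain `L^{−kd}`).  (ii) Of the derivative members only the COVARIANT DERIVATIVE, in KERNEL form at the source `δ_y`,
in the gauge of (iii) (§7, v1.1), and for (2.27)/(2.28) under DISPLAYED support/smoothness hypotheses on the weights `λ_α` and the cut-off
`ζ″` in the output point (§8, v1.2; their discharge for the torus data of record — p29's `BIJ88LocWeights227Torus.lamFam`, p13's cut-off — is
not done here); no Hölder-derivative members ([6] (1.9), the *"Hölder derivatives"* clause of the p. 263 sentence); §5 (gauge transforms) is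
not restated for the derivative.  (iii) The smallness hypothesis is bondwise inside `Ω` (a gauge in
which `u` is near `1` on `Ω`, as print's *"exp[ie_kηA] … A small"*), transported to every gauge transform by §5; that the (7.3.1)/(4.5.4)
backgrounds of record meet it is p33's `BIJ85Ineq732Background` (`holCK_bg454`, `norm_toC_phase_sub_one_le`), not restated.  (iv) Any `d`,
any `L ≥ 2`, `1 ≤ k ≤ m + K`; constants `t₀, c₀` explicit, depending on `(d, a)` only.  (v) Regions: finite unions of `k`-blocks of the
fine torus `T^{(0)}` (for the cubes `□_α` of (2.27): p31's `isBlockUnion_cubeT`); no wrap-around condition is needed.  DIVERGENCE OF METHOD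
as stated.  Nothing here is summit progress.  Unit `lit-balaban-p34` (literature-prover-lit-balaban-p34-g16-0), HOME
`run/shared/lean/pub/lit-balaban/`, 2026-08-22; v1.1 (§7 appended, §1–§6 byte-identical) 2026-08-23; v1.2 (§8 appended, §1–§7
byte-identical) 2026-08-23.
-/

open scoped BigOperators ComplexConjugate
open Finset Matrix

namespace Literature.MathematicalPhysics.QuantumFieldTheory.BalabanImbrieJaffe1984to88.BIJ88NeumannPropagatorSmallFieldRegion

open Literature.MathematicalPhysics.QuantumFieldTheory.Balaban1983to89
open LatticeFieldCalculus (supDist)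
open BIJ88Sect3Statements (U1 toC cfg covD starB mem_starB norm_toC)
open BIJ85BlockAveragesTorus BIJ85BlockAveragesTorusK
open BIJ88NeumannNoZeroModesTorus (IsBlockUnion innerK mem_innerK)
open BIJ88NeumannPropagator227Torus (nOp gBox dN qMatK proj nOp_eq qMatK_mulVec dN_mulVec proj_mulVec isUnit_nPad nOp_mul_gBox
  gBox_apply_eq_zero conj_mul_toC toC_mul_conj)
open BIJ88DeltaLoc234Torus (mulOp gBox_gaugeAct_apply gTilde gLocT gTilde_apply gLocT_apply)
open GaugeField (gaugeAct)

noncomputable section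

variable {P : Params} {j : ℕ}

/-! ## §1 The sesquilinear form of the Neumann operator on `Ω`; the equation and the support of `G_k(Ω,u)f` -/

/-- kernel: `ψᴴ((AᴴA)φ) = (Aψ)ᴴ(Aφ)` for a Gram matrix. [cite: BalabanImbrieJaffe1988, (5.6.10) p.287] -/
theorem star_dotProduct_gram_mulVec {m n : Type*} [Fintype m] [Fintype n] (A : Matrix m n ℂ) (ψ φ : n → ℂ) :
    star ψ ⬝ᵥ ((Aᴴ * A) *ᵥ φ) = star (A *ᵥ ψ) ⬝ᵥ (A *ᵥ φ) := by
  rw [← mulVec_mulVec, dotProduct_mulVec, vecMul_conjTranspose, star_star]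

/-- **THE SESQUILINEAR NEUMANN FORM ON THE REGION**: `ψᴴ(nOp φ) = Σ_{b∈Ω*} conj((D_uψ)(b))·(D_uφ)(b) + a·Σ_{B^k(y)⊆Ω} conj((Q_k(u)ψ)(y))·(Q_k(u)φ)(y)`
((5.6.10): *"the basic quadratic form with Neumann boundary conditions on Ω"*, polarized). [cite: BalabanImbrieJaffe1988, (5.6.10) p.287] -/
theorem form_nOp_eq (a c : ℝ) (U : GaugeField P j U1) (k : ℕ) (Ω : Finset (Balaban1983to89.Site P j))
    (ψ φ : Balaban1983to89.Site P j → ℂ) :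
    star ψ ⬝ᵥ (nOp a c U k Ω *ᵥ φ) =
      ∑ b ∈ starB Ω, conj (covD c (cfg U) ψ b) * covD c (cfg U) φ b +
        (a : ℂ) * ∑ y ∈ innerK k Ω, conj (qCovK U k ψ y) * qCovK U k φ y := by
  classical
  rw [nOp_eq, add_mulVec, smul_mulVec, dotProduct_add, dotProduct_smul, star_dotProduct_gram_mulVec,
    star_dotProduct_gram_mulVec, smul_eq_mul]
  congr 1
  · simp only [dotProduct, Pi.star_apply, dN_mulVec]
    rw [← Finset.sum_filter_add_sum_filter_not univ (fun b => b ∈ starB Ω)]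
    have h0 : ∑ b ∈ univ.filter (fun b => ¬ b ∈ starB Ω),
        star (if b ∈ starB Ω then covD c (cfg U) ψ b else 0) * (if b ∈ starB Ω then covD c (cfg U) φ b else 0) = 0 :=
      sum_eq_zero fun b hb => by rw [if_neg (mem_filter.1 hb).2, if_neg (mem_filter.1 hb).2, mul_zero]
    rw [h0, add_zero]
    have hS : univ.filter (fun b : PBond P j => b ∈ starB Ω) = starB Ω := by ext b; simp
    rw [hS]
    refine sum_congr rfl fun b hb => ?_
    rw [if_pos hb, if_pos hb, Complex.star_def]
  · congr 1
    simp only [dotProduct, Pi.star_apply, qMatK_mulVec]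
    rw [innerK, sum_filter]
    refine sum_congr rfl fun y _ => ?_
    by_cases h : blockK k y ⊆ Ω
    · rw [if_pos h, if_pos h, if_pos h, Complex.star_def]
    · rw [if_neg h, if_neg h, if_neg h, mul_zero]

/-- **THE NEUMANN QUADRATIC FORM**: `Re χᴴ(nOp χ) = Σ_{b∈Ω*}‖(D_uχ)(b)‖² + a·Σ_{B^k(y)⊆Ω}‖(Q_k(u)χ)(y)‖²`. [cite: BalabanImbrieJaffe1988, (5.6.10) p.287] -/
theorem re_form_nOp_self (a c : ℝ) (U : GaugeField P j U1) (k : ℕ) (Ω : Finset (Balaban1983to89.Site P j))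
    (χ : Balaban1983to89.Site P j → ℂ) :
    (star χ ⬝ᵥ (nOp a c U k Ω *ᵥ χ)).re =
      ∑ b ∈ starB Ω, ‖covD c (cfg U) χ b‖ ^ 2 + a * ∑ y ∈ innerK k Ω, ‖qCovK U k χ y‖ ^ 2 := by
  rw [form_nOp_eq, Complex.add_re, Complex.re_sum, Complex.re_ofReal_mul, Complex.re_sum]
  congr 1
  · exact sum_congr rfl fun b _ => by rw [Complex.conj_mul', ← Complex.ofReal_pow, Complex.ofReal_re]
  · congr 1
    exact sum_congr rfl fun y _ => by rw [Complex.conj_mul', ← Complex.ofReal_pow, Complex.ofReal_re]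

/-- kernel: **`G_k(Ω,u)f` IS SUPPORTED IN `Ω`** (the inverse on `ℓ²(Ω)` extended by zero). [cite: BalabanImbrieJaffe1988, (2.27) p.263] -/
theorem gBox_mulVec_eq_zero_of_not_mem {k : ℕ} (hk : j + k ≤ P.m + P.K) {a c : ℝ} (hc : c ≠ 0) (ha : 0 < a) (U : GaugeField P j U1)
    {Ω : Finset (Balaban1983to89.Site P j)} (hΩ : IsBlockUnion k Ω) (f : Balaban1983to89.Site P j → ℂ) {x : Balaban1983to89.Site P j}
    (hx : x ∉ Ω) : (gBox a c U k Ω *ᵥ f) x = 0 := by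
  have hN := isUnit_nPad hk hc ha U hΩ
  simp only [mulVec, dotProduct]
  exact sum_eq_zero fun y _ => by rw [gBox_apply_eq_zero hN (Or.inl hx), zero_mul]

/-- kernel: **THE EQUATION** `nOp(G_k(Ω,u)f) = 1_Ωf` (`nOp·G_k(Ω,u) = 1_Ω`, gen 15). [cite: BalabanImbrieJaffe1988, (2.27) p.263] -/
theorem nOp_mulVec_gBox_mulVec {k : ℕ} (hk : j + k ≤ P.m + P.K) {a c : ℝ} (hc : c ≠ 0) (ha : 0 < a) (U : GaugeField P j U1)
    {Ω : Finset (Balaban1983to89.Site P j)} (hΩ : IsBlockUnion k Ω) (f : Balaban1983to89.Site P j → ℂ) :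
    nOp a c U k Ω *ᵥ (gBox a c U k Ω *ᵥ f) = proj Ω *ᵥ f := by
  rw [mulVec_mulVec, nOp_mul_gBox (isUnit_nPad hk hc ha U hΩ)]

/-! ## §2 Coercivity of the Neumann form on `Ω`-supported fields (the `k`-block Poincaré inequality applied to the blocks of `Ω` only) -/

/-- Jensen / Cauchy–Schwarz on a finite set: `|Σ_{x∈s} a_x|² ≤ |s|·Σ_{x∈s}|a_x|²`. [folklore] -/
private theorem norm_sum_sq_le_card_mul' {ι : Type*} (s : Finset ι) (a : ι → ℂ) :
    ‖∑ x ∈ s, a x‖ ^ 2 ≤ s.card * ∑ x ∈ s, ‖a x‖ ^ 2 :=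
  calc ‖∑ x ∈ s, a x‖ ^ 2 ≤ (∑ x ∈ s, ‖a x‖) ^ 2 := pow_le_pow_left₀ (norm_nonneg _) (norm_sum_le _ _) 2
    _ ≤ s.card * ∑ x ∈ s, ‖a x‖ ^ 2 := sq_sum_le_card_mul_sum_sq

/-- `|a + b|² ≤ 2|a|² + 2|b|²`. [folklore] -/
private theorem norm_add_sq_le_two' (a b : ℂ) : ‖a + b‖ ^ 2 ≤ 2 * ‖a‖ ^ 2 + 2 * ‖b‖ ^ 2 := by
  have h1 : ‖a + b‖ ^ 2 ≤ (‖a‖ + ‖b‖) ^ 2 := pow_le_pow_left₀ (norm_nonneg _) (norm_add_le a b) 2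
  nlinarith [sq_nonneg (‖a‖ - ‖b‖)]

/-- **THE `k`-BLOCK POINCARÉ INEQUALITY RESTRICTED TO THE REGION** (p33's `sum_norm_sq_le_cov`, blocks of `Ω` only): for a union `Ω` of
`k`-blocks, a `U(1)` field with `|u_b − 1| ≤ T` on the bonds of `Ω*` with both ends in one `k`-block and `|u(Γ^{(k)}_{x_k,x}) − 1| ≤ δ` on
`Ω`, and every `χ` supported in `Ω` (`n = L^k`, `N = L^{kd}`):
`(1 − 2(n−1)n·d·T² − 2δ²)·Σ_x|χ(x)|² ≤ 2(n−1)n·Σ_{b∈Ω*}|u_bχ(b₊) − χ(b₋)|² + 2N·Σ_{B^k(y)⊆Ω}|(Q_k(u)χ)(y)|²`.  The `η`-lattice Poincaré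
step of *"the proofs of [7]"* with Neumann conditions on `Ω`. [cite: BalabanImbrieJaffe1985, (7.3.2) p.326] -/
theorem coercive_region_poincare {k : ℕ} (hk : j + k ≤ P.m + P.K) {Ω : Finset (Balaban1983to89.Site P j)} (hΩ : IsBlockUnion k Ω)
    (U : GaugeField P j U1) {T δ : ℝ}
    (hInt : ∀ b ∈ starB Ω, blkIter k b.src = blkIter k b.tgt → ‖toC (U b) - 1‖ ≤ T)
    (hTree : ∀ x ∈ Ω, ‖holCK U k x - 1‖ ≤ δ)
    (χ : Balaban1983to89.Site P j → ℂ) (hχ : ∀ x, x ∉ Ω → χ x = 0) :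
    (1 - (2 * (((P.L : ℝ) ^ k - 1) * (P.L : ℝ) ^ k) * P.d * T ^ 2 + 2 * δ ^ 2))
        * ∑ x : Balaban1983to89.Site P j, ‖χ x‖ ^ 2
      ≤ 2 * (((P.L : ℝ) ^ k - 1) * (P.L : ℝ) ^ k) * ∑ b ∈ starB Ω, ‖toC (U b) * χ b.tgt - χ b.src‖ ^ 2
        + 2 * (P.L : ℝ) ^ (k * P.d) * ∑ y ∈ innerK k Ω, ‖qCovK U k χ y‖ ^ 2 := by
  classical
  set C : ℝ := ((P.L : ℝ) ^ k - 1) * (P.L : ℝ) ^ k / 2 with hCdef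
  set N : ℝ := (P.L : ℝ) ^ (k * P.d) with hNdef
  have hNpos : 0 < N := pow_pos (Nat.cast_pos.2 P.L_pos) _
  have hC0 : 0 ≤ C := by
    have h1 : (1 : ℝ) ≤ (P.L : ℝ) ^ k := one_le_pow₀ (by exact_mod_cast P.L_pos)
    have : 0 ≤ (P.L : ℝ) ^ k - 1 := by linarith
    positivity
  -- trivial when `Ω` is empty-ish: we only need `T, δ ≥ 0` when a site of `Ω` exists; handle signs via squares
  set D : PBond P j → ℝ := fun b => ‖toC (U b) * χ b.tgt - χ b.src‖ ^ 2 with hD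
  set S : Balaban1983to89.Site P (j + k) → Finset (PBond P j) :=
    fun y => univ.filter (fun b : PBond P j => blkIter k b.src = y ∧ blkIter k b.tgt = y) with hS
  -- the bound on one block INSIDE `Ω`
  have hblock : ∀ y ∈ innerK k Ω,
      ∑ x ∈ blockK k y, ‖χ x‖ ^ 2
        ≤ 2 * (C * ∑ b ∈ S y, (2 * D b + 2 * (T ^ 2 * ‖χ b.tgt‖ ^ 2))) + 2 * (δ ^ 2 * ∑ x ∈ blockK k y, ‖χ x‖ ^ 2)
          + 2 * N * ‖qCovK U k χ y‖ ^ 2 := by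
    intro y hy
    have hyΩ : blockK k y ⊆ Ω := mem_innerK.1 hy
    set c : ℂ := qCovK U k χ y with hc
    have h1 : ∑ x ∈ blockK k y, ‖χ x‖ ^ 2 ≤ 2 * ∑ x ∈ blockK k y, ‖χ x - c‖ ^ 2 + 2 * N * ‖c‖ ^ 2 := by
      calc ∑ x ∈ blockK k y, ‖χ x‖ ^ 2 ≤ ∑ x ∈ blockK k y, (2 * ‖χ x - c‖ ^ 2 + 2 * ‖c‖ ^ 2) :=
            sum_le_sum fun x _ => by
              have h := norm_add_sq_le_two' (χ x - c) c
              rwa [sub_add_cancel] at h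
        _ = 2 * ∑ x ∈ blockK k y, ‖χ x - c‖ ^ 2 + 2 * N * ‖c‖ ^ 2 := by
            rw [sum_add_distrib, ← mul_sum, sum_const, card_blockK k hk y, nsmul_eq_mul, Nat.cast_pow, hNdef]; ring
    have h2 := BIJ85BlockKPoincare.sum_norm_sub_sq_le hk y χ c
    have h3 : ∑ b ∈ S y, ‖χ b.tgt - χ b.src‖ ^ 2 ≤ ∑ b ∈ S y, (2 * D b + 2 * (T ^ 2 * ‖χ b.tgt‖ ^ 2)) := by
      refine sum_le_sum fun b hb => ?_
      have hb2 : blkIter k b.src = y ∧ blkIter k b.tgt = y := by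
        simpa only [hS, mem_filter, mem_univ, true_and] using hb
      have hb' : blkIter k b.src = blkIter k b.tgt := by rw [hb2.1, hb2.2]
      have hbstar : b ∈ starB Ω :=
        (mem_starB Ω b).2 ⟨hyΩ (mem_blockK.2 hb2.1), hyΩ (mem_blockK.2 hb2.2)⟩
      have e : χ b.tgt - χ b.src = (toC (U b) * χ b.tgt - χ b.src) + (1 - toC (U b)) * χ b.tgt := by ring
      rw [e]
      refine (norm_add_sq_le_two' _ _).trans (add_le_add le_rfl (mul_le_mul_of_nonneg_left ?_ (by norm_num)))
      rw [norm_mul, mul_pow]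
      refine mul_le_mul_of_nonneg_right ?_ (sq_nonneg _)
      rw [norm_sub_rev]
      exact pow_le_pow_left₀ (norm_nonneg _) (hInt b hbstar hb') 2
    have h4 : N⁻¹ * ‖∑ x ∈ blockK k y, (χ x - c)‖ ^ 2 ≤ δ ^ 2 * ∑ x ∈ blockK k y, ‖χ x‖ ^ 2 := by
      rw [hc, BIJ85BlockKPoincare.sum_sub_qCovK_eq hk U χ y]
      have h5 := norm_sum_sq_le_card_mul' (blockK k y) (fun x => (1 - holCK U k x) * χ x)
      rw [card_blockK k hk y, Nat.cast_pow] at h5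
      have h6 : ∑ x ∈ blockK k y, ‖(1 - holCK U k x) * χ x‖ ^ 2 ≤ δ ^ 2 * ∑ x ∈ blockK k y, ‖χ x‖ ^ 2 := by
        rw [mul_sum]
        refine sum_le_sum fun x hx => ?_
        rw [norm_mul, mul_pow]
        refine mul_le_mul_of_nonneg_right ?_ (sq_nonneg _)
        rw [norm_sub_rev]
        exact pow_le_pow_left₀ (norm_nonneg _) (hTree x (hyΩ hx)) 2
      calc N⁻¹ * ‖∑ x ∈ blockK k y, (1 - holCK U k x) * χ x‖ ^ 2
          ≤ N⁻¹ * (N * (δ ^ 2 * ∑ x ∈ blockK k y, ‖χ x‖ ^ 2)) :=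
            mul_le_mul_of_nonneg_left (h5.trans (mul_le_mul_of_nonneg_left h6 hNpos.le)) (inv_nonneg.2 hNpos.le)
        _ = δ ^ 2 * ∑ x ∈ blockK k y, ‖χ x‖ ^ 2 := by rw [← mul_assoc, inv_mul_cancel₀ hNpos.ne', one_mul]
    have h23 : ∑ x ∈ blockK k y, ‖χ x - c‖ ^ 2
        ≤ C * ∑ b ∈ S y, (2 * D b + 2 * (T ^ 2 * ‖χ b.tgt‖ ^ 2)) + δ ^ 2 * ∑ x ∈ blockK k y, ‖χ x‖ ^ 2 :=
      h2.trans (add_le_add (mul_le_mul_of_nonneg_left h3 hC0) h4)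
    linarith [h1, h23]
  -- the total: sites off the blocks of `Ω` do not contribute
  have htot : ∑ x : Balaban1983to89.Site P j, ‖χ x‖ ^ 2 = ∑ y ∈ innerK k Ω, ∑ x ∈ blockK k y, ‖χ x‖ ^ 2 := by
    rw [← BIJ85BlockAveragingIneq.sum_blockK_sum (k := k) (fun x => ‖χ x‖ ^ 2)]
    symm
    refine sum_subset (subset_univ _) fun y _ hy => sum_eq_zero fun x hx => ?_
    have hxΩ : x ∉ Ω := fun hxΩ => hy (mem_innerK.2 (by rw [← mem_blockK.1 hx]; exact hΩ x hxΩ))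
    rw [hχ x hxΩ, norm_zero, sq, zero_mul]
  -- in-block bonds of the blocks of `Ω`, summed, are dominated by the bonds of `Ω*`
  have hsumS : ∀ G : PBond P j → ℝ, (∀ b, 0 ≤ G b) →
      ∑ y ∈ innerK k Ω, ∑ b ∈ S y, G b ≤ ∑ b ∈ starB Ω, G b := by
    intro G hG
    calc ∑ y ∈ innerK k Ω, ∑ b ∈ S y, G b
        ≤ ∑ y ∈ innerK k Ω, ∑ b ∈ (starB Ω).filter (fun b : PBond P j => blkIter k b.src = y), G b :=
          sum_le_sum fun y hy => sum_le_sum_of_subset_of_nonneg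
            (fun b hb => by
              have hb2 : blkIter k b.src = y ∧ blkIter k b.tgt = y := by
                simpa only [hS, mem_filter, mem_univ, true_and] using hb
              have hyΩ : blockK k y ⊆ Ω := mem_innerK.1 hy
              exact mem_filter.2 ⟨(mem_starB Ω b).2 ⟨hyΩ (mem_blockK.2 hb2.1), hyΩ (mem_blockK.2 hb2.2)⟩, hb2.1⟩)
            fun _ _ _ => hG _
      _ ≤ ∑ y : Balaban1983to89.Site P (j + k), ∑ b ∈ (starB Ω).filter (fun b : PBond P j => blkIter k b.src = y), G b :=
          sum_le_sum_of_subset_of_nonneg (subset_univ _) fun _ _ _ => sum_nonneg fun b _ => hG b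
      _ = ∑ b ∈ starB Ω, G b := sum_fiberwise (starB Ω) (fun b : PBond P j => blkIter k b.src) G
  -- the `T²`-term over all bonds
  have hsumT : ∑ y ∈ innerK k Ω, ∑ b ∈ S y, ‖χ b.tgt‖ ^ 2 ≤ P.d * ∑ x : Balaban1983to89.Site P j, ‖χ x‖ ^ 2 := by
    calc ∑ y ∈ innerK k Ω, ∑ b ∈ S y, ‖χ b.tgt‖ ^ 2
        ≤ ∑ y : Balaban1983to89.Site P (j + k), ∑ b ∈ univ.filter (fun b : PBond P j => blkIter k b.src = y), ‖χ b.tgt‖ ^ 2 :=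
          (sum_le_sum fun y _ => sum_le_sum_of_subset_of_nonneg
            (fun b hb => by simp only [hS, mem_filter, mem_univ, true_and] at hb ⊢; exact hb.1) fun _ _ _ => sq_nonneg _).trans
          (sum_le_sum_of_subset_of_nonneg (subset_univ _) fun _ _ _ => sum_nonneg fun _ _ => sq_nonneg _)
      _ = ∑ b : PBond P j, ‖χ b.tgt‖ ^ 2 := sum_fiberwise univ (fun b : PBond P j => blkIter k b.src) _
      _ = P.d * ∑ x : Balaban1983to89.Site P j, ‖χ x‖ ^ 2 := by
          rw [BIJ85BlockAveragingIneq.sum_bond_eq]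
          exact BIJ85BlockAveragingIneq.sum_sum_shift_dir (fun x => ‖χ x‖ ^ 2)
  have hI1 : ∑ y ∈ innerK k Ω, ∑ b ∈ S y, (2 * D b + 2 * (T ^ 2 * ‖χ b.tgt‖ ^ 2))
      ≤ 2 * ∑ b ∈ starB Ω, D b + 2 * T ^ 2 * (P.d * ∑ x : Balaban1983to89.Site P j, ‖χ x‖ ^ 2) := by
    have e : ∑ y ∈ innerK k Ω, ∑ b ∈ S y, (2 * D b + 2 * (T ^ 2 * ‖χ b.tgt‖ ^ 2)) =
        2 * ∑ y ∈ innerK k Ω, ∑ b ∈ S y, D b + 2 * T ^ 2 * ∑ y ∈ innerK k Ω, ∑ b ∈ S y, ‖χ b.tgt‖ ^ 2 := by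
      simp_rw [sum_add_distrib, ← mul_sum, ← mul_assoc]
    rw [e]
    have hA := hsumS D fun b => by positivity
    have hB := mul_le_mul_of_nonneg_left hsumT (by positivity : (0 : ℝ) ≤ 2 * T ^ 2)
    linarith
  have hmain : ∑ x : Balaban1983to89.Site P j, ‖χ x‖ ^ 2
      ≤ 2 * (C * (2 * ∑ b ∈ starB Ω, D b + 2 * T ^ 2 * (P.d * ∑ x : Balaban1983to89.Site P j, ‖χ x‖ ^ 2)))
        + 2 * (δ ^ 2 * ∑ x : Balaban1983to89.Site P j, ‖χ x‖ ^ 2)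
        + 2 * N * ∑ y ∈ innerK k Ω, ‖qCovK U k χ y‖ ^ 2 := by
    calc ∑ x : Balaban1983to89.Site P j, ‖χ x‖ ^ 2
        = ∑ y ∈ innerK k Ω, ∑ x ∈ blockK k y, ‖χ x‖ ^ 2 := htot
      _ ≤ ∑ y ∈ innerK k Ω,
            (2 * (C * ∑ b ∈ S y, (2 * D b + 2 * (T ^ 2 * ‖χ b.tgt‖ ^ 2))) + 2 * (δ ^ 2 * ∑ x ∈ blockK k y, ‖χ x‖ ^ 2)
              + 2 * N * ‖qCovK U k χ y‖ ^ 2) := sum_le_sum fun y hy => hblock y hy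
      _ = 2 * (C * ∑ y ∈ innerK k Ω, ∑ b ∈ S y, (2 * D b + 2 * (T ^ 2 * ‖χ b.tgt‖ ^ 2)))
          + 2 * (δ ^ 2 * ∑ y ∈ innerK k Ω, ∑ x ∈ blockK k y, ‖χ x‖ ^ 2)
          + 2 * N * ∑ y ∈ innerK k Ω, ‖qCovK U k χ y‖ ^ 2 := by
          rw [sum_add_distrib, sum_add_distrib, ← mul_sum, ← mul_sum, ← mul_sum, ← mul_sum, ← mul_sum]
      _ ≤ _ := by
          rw [← htot]
          have := mul_le_mul_of_nonneg_left hI1 hC0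
          linarith
  have hCe : 2 * (((P.L : ℝ) ^ k - 1) * (P.L : ℝ) ^ k) = 4 * C := by rw [hCdef]; ring
  rw [hCe]
  nlinarith [hmain, hC0, sq_nonneg T, sq_nonneg δ,
    sum_nonneg (fun x (_ : x ∈ (univ : Finset (Balaban1983to89.Site P j))) => sq_nonneg ‖χ x‖),
    sum_nonneg (fun b (_ : b ∈ starB Ω) => sq_nonneg ‖toC (U b) * χ b.tgt - χ b.src‖)]

/-- **COERCIVITY OF THE NEUMANN FORM ON `Ω`-SUPPORTED FIELDS**: under the bondwise smallness inside `Ω` with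
`2(n−1)n·d·T² + 2δ² ≤ 1/2`, for `a > 0` and every `χ` supported in `Ω`:
`min(c²/(4n²), a/(4N))·Σ_x|χ(x)|² ≤ Re χᴴ(nOp a c u k Ω)χ = Σ_{b∈Ω*}|(D_uχ)(b)|² + aΣ_{B^k(y)⊆Ω}|(Q_k(u)χ)(y)|²` (p. 264 *"by (2.38), …
is bounded below by O(1) Δ"*, here the Neumann form on a region; the lower bound of [I] (7.3.2) localized to `Ω`).
[cite: BalabanImbrieJaffe1985, (7.3.2) p.326] -/
theorem coercive_region {k : ℕ} (hk : j + k ≤ P.m + P.K) {Ω : Finset (Balaban1983to89.Site P j)} (hΩ : IsBlockUnion k Ω)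
    (U : GaugeField P j U1) {T δ : ℝ}
    (hInt : ∀ b ∈ starB Ω, blkIter k b.src = blkIter k b.tgt → ‖toC (U b) - 1‖ ≤ T)
    (hTree : ∀ x ∈ Ω, ‖holCK U k x - 1‖ ≤ δ)
    (hsmall : 2 * (((P.L : ℝ) ^ k - 1) * (P.L : ℝ) ^ k) * P.d * T ^ 2 + 2 * δ ^ 2 ≤ 1 / 2)
    (c : ℝ) {a : ℝ} (ha : 0 < a) (χ : Balaban1983to89.Site P j → ℂ) (hχ : ∀ x, x ∉ Ω → χ x = 0) :
    min (c ^ 2 / (4 * ((P.L : ℝ) ^ k) ^ 2)) (a / (4 * (P.L : ℝ) ^ (k * P.d))) * ∑ x : Balaban1983to89.Site P j, ‖χ x‖ ^ 2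
      ≤ (star χ ⬝ᵥ (nOp a c U k Ω *ᵥ χ)).re := by
  rw [re_form_nOp_self]
  have hP := coercive_region_poincare hk hΩ U hInt hTree χ hχ
  set Ssum : ℝ := ∑ x : Balaban1983to89.Site P j, ‖χ x‖ ^ 2 with hSsum
  set E : ℝ := ∑ b ∈ starB Ω, ‖toC (U b) * χ b.tgt - χ b.src‖ ^ 2 with hE
  set Qn : ℝ := ∑ y ∈ innerK k Ω, ‖qCovK U k χ y‖ ^ 2 with hQn
  have hn : 0 < ((P.L : ℝ) ^ k) ^ 2 := pow_pos (pow_pos P.cast_L_pos _) _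
  have hLk : (P.L : ℝ) ^ k ≠ 0 := (pow_pos P.cast_L_pos _).ne'
  have hN : 0 < (P.L : ℝ) ^ (k * P.d) := pow_pos P.cast_L_pos _
  have hS0 : 0 ≤ Ssum := sum_nonneg fun _ _ => sq_nonneg _
  have hE0 : 0 ≤ E := sum_nonneg fun _ _ => sq_nonneg _
  have hQ0 : 0 ≤ Qn := sum_nonneg fun _ _ => sq_nonneg _
  -- the form in terms of `E`: `Σ_{b∈Ω*}‖(D_uχ)(b)‖² = c²·E`
  have hD : ∑ b ∈ starB Ω, ‖covD c (cfg U) χ b‖ ^ 2 = c ^ 2 * E := by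
    rw [hE, mul_sum]
    refine sum_congr rfl fun b _ => ?_
    unfold covD cfg
    rw [norm_mul, mul_pow, Complex.norm_real, Real.norm_eq_abs, sq_abs]
  rw [hD]
  -- from the Poincaré inequality: `Ssum/2 ≤ 2(n−1)n·E + 2N·Qn ≤ 2n²·E + 2N·Qn`
  have h1 : Ssum / 2 ≤ 2 * ((P.L : ℝ) ^ k) ^ 2 * E + 2 * (P.L : ℝ) ^ (k * P.d) * Qn := by
    have h2 : 2 * (((P.L : ℝ) ^ k - 1) * (P.L : ℝ) ^ k) * E ≤ 2 * ((P.L : ℝ) ^ k) ^ 2 * E := by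
      have : ((P.L : ℝ) ^ k - 1) * (P.L : ℝ) ^ k ≤ ((P.L : ℝ) ^ k) ^ 2 := by nlinarith [pow_pos P.cast_L_pos k]
      nlinarith
    nlinarith [hP, h2]
  -- `m₁·Ssum ≤ c²E + aQn`
  set m₁ := min (c ^ 2 / (4 * ((P.L : ℝ) ^ k) ^ 2)) (a / (4 * (P.L : ℝ) ^ (k * P.d))) with hm₁
  have hmE : m₁ * (4 * ((P.L : ℝ) ^ k) ^ 2 * E) ≤ c ^ 2 * E := by
    have hle := min_le_left (c ^ 2 / (4 * ((P.L : ℝ) ^ k) ^ 2)) (a / (4 * (P.L : ℝ) ^ (k * P.d)))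
    calc m₁ * (4 * ((P.L : ℝ) ^ k) ^ 2 * E) ≤ (c ^ 2 / (4 * ((P.L : ℝ) ^ k) ^ 2)) * (4 * ((P.L : ℝ) ^ k) ^ 2 * E) :=
          mul_le_mul_of_nonneg_right hle (by positivity)
      _ = c ^ 2 * E := by field_simp
  have hmQ : m₁ * (4 * (P.L : ℝ) ^ (k * P.d) * Qn) ≤ a * Qn := by
    have hle := min_le_right (c ^ 2 / (4 * ((P.L : ℝ) ^ k) ^ 2)) (a / (4 * (P.L : ℝ) ^ (k * P.d)))
    calc m₁ * (4 * (P.L : ℝ) ^ (k * P.d) * Qn) ≤ (a / (4 * (P.L : ℝ) ^ (k * P.d))) * (4 * (P.L : ℝ) ^ (k * P.d) * Qn) :=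
          mul_le_mul_of_nonneg_right hle (by positivity)
      _ = a * Qn := by field_simp
  have hm0 : 0 ≤ m₁ := le_min (by positivity) (by positivity)
  calc m₁ * Ssum = m₁ * (2 * (Ssum / 2)) := by ring
    _ ≤ m₁ * (2 * (2 * ((P.L : ℝ) ^ k) ^ 2 * E + 2 * (P.L : ℝ) ^ (k * P.d) * Qn)) :=
        mul_le_mul_of_nonneg_left (by linarith) hm0
    _ = m₁ * (4 * ((P.L : ℝ) ^ k) ^ 2 * E) + m₁ * (4 * (P.L : ℝ) ^ (k * P.d) * Qn) := by ring
    _ ≤ c ^ 2 * E + a * Qn := add_le_add hmE hmQ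

/-! ## §3 The Agmon (Combes–Thomas) weighted `ℓ²` bound for the region propagator `G_k(Ω,u)` -/

/-- kernel, the BOND DEFECT: for complex `a, b` and reals `p, q`, `|pa − qb|² = Re[conj(p²a − q²b)(a − b)] + (p − q)²Re(āb)`, hence
`|pa − qb|² ≤ Re[conj(p²a − q²b)(a − b)] + (p − q)²|a||b|`. [folklore] -/
private theorem bond_defect_le (a b : ℂ) (p q : ℝ) :
    ‖(p : ℂ) * a - (q : ℂ) * b‖ ^ 2 ≤ (conj ((p : ℂ) ^ 2 * a - (q : ℂ) ^ 2 * b) * (a - b)).re + (p - q) ^ 2 * (‖a‖ * ‖b‖) := by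
  have key : ‖(p : ℂ) * a - (q : ℂ) * b‖ ^ 2 = (conj ((p : ℂ) ^ 2 * a - (q : ℂ) ^ 2 * b) * (a - b)).re + (p - q) ^ 2 * (conj a * b).re := by
    rw [Complex.sq_norm, Complex.normSq_apply]
    simp only [Complex.mul_re, Complex.sub_re, Complex.sub_im, Complex.mul_im, Complex.conj_re, Complex.conj_im,
      Complex.ofReal_re, Complex.ofReal_im, map_sub, map_mul, map_pow, Complex.conj_ofReal]
    simp only [sq, Complex.mul_re, Complex.mul_im, Complex.ofReal_re, Complex.ofReal_im]
    ring
  rw [key]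
  refine add_le_add le_rfl (mul_le_mul_of_nonneg_left ?_ (sq_nonneg _))
  calc (conj a * b).re ≤ ‖conj a * b‖ := Complex.re_le_norm _
    _ = ‖a‖ * ‖b‖ := by rw [norm_mul, RCLike.norm_conj]

/-- kernel, the BLOCK DEFECT by symmetrization: for complex `a_x` and positive reals `ω_x` on a finite set `B` with
`(ω_x − ω_{x′})² ≤ S₂ω_xω_{x′}`,  `|Σ ω_xa_x|² − Re[conj(Σ ω_x²a_x)(Σ a_x)] = −½ΣΣ(ω_x − ω_{x′})²Re(ā_xa_{x′}) ≤ (S₂/2)(Σ ω_x|a_x|)²`. [folklore] -/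
private theorem block_defect_le {ι : Type*} (B : Finset ι) (a : ι → ℂ) (ω : ι → ℝ) {S₂ : ℝ}
    (hosc : ∀ x ∈ B, ∀ x' ∈ B, (ω x - ω x') ^ 2 ≤ S₂ * (ω x * ω x')) :
    ‖∑ x ∈ B, (ω x : ℂ) * a x‖ ^ 2 - (conj (∑ x ∈ B, (ω x : ℂ) ^ 2 * a x) * ∑ x ∈ B, a x).re
      ≤ S₂ / 2 * (∑ x ∈ B, ω x * ‖a x‖) ^ 2 := by
  -- the double-sum expression `M(x,x′) = (ω_xω_{x′} − ω_x²)·Re(conj(a_x)a_{x′})`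
  set M : ι → ι → ℝ := fun x x' => (ω x * ω x' - ω x ^ 2) * (conj (a x) * a x').re with hM
  have hL : ‖∑ x ∈ B, (ω x : ℂ) * a x‖ ^ 2 - (conj (∑ x ∈ B, (ω x : ℂ) ^ 2 * a x) * ∑ x ∈ B, a x).re
      = ∑ x ∈ B, ∑ x' ∈ B, M x x' := by
    have e1 : ‖∑ x ∈ B, (ω x : ℂ) * a x‖ ^ 2 = (conj (∑ x ∈ B, (ω x : ℂ) * a x) * ∑ x ∈ B, (ω x : ℂ) * a x).re := by
      rw [Complex.conj_mul', ← Complex.ofReal_pow, Complex.ofReal_re]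
    rw [e1, map_sum, map_sum, sum_mul_sum, sum_mul_sum, Complex.re_sum, Complex.re_sum, ← sum_sub_distrib]
    refine sum_congr rfl fun x _ => ?_
    rw [Complex.re_sum, Complex.re_sum, ← sum_sub_distrib]
    refine sum_congr rfl fun x' _ => ?_
    rw [hM]
    simp only [map_mul, map_pow, Complex.conj_ofReal]
    have e2 : (ω x : ℂ) * conj (a x) * ((ω x' : ℂ) * a x') = ((ω x * ω x' : ℝ) : ℂ) * (conj (a x) * a x') := by push_cast; ring
    have e3 : (ω x : ℂ) ^ 2 * conj (a x) * a x' = ((ω x ^ 2 : ℝ) : ℂ) * (conj (a x) * a x') := by push_cast; ring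
    rw [e2, e3, Complex.re_ofReal_mul, Complex.re_ofReal_mul]
    ring
  rw [hL]
  -- symmetrize: `ΣΣ M(x,x′) = ½ΣΣ (M(x,x′) + M(x′,x)) = −½ΣΣ(ω_x − ω_{x′})²Re(conj(a_x)a_{x′})`
  have hsym : ∑ x ∈ B, ∑ x' ∈ B, M x x' = ∑ x ∈ B, ∑ x' ∈ B, (-(1 / 2 : ℝ)) * ((ω x - ω x') ^ 2 * (conj (a x) * a x').re) := by
    have hswap : ∑ x ∈ B, ∑ x' ∈ B, M x x' = ∑ x ∈ B, ∑ x' ∈ B, M x' x := sum_comm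
    have hre : ∀ x x', (conj (a x') * a x).re = (conj (a x) * a x').re := fun x x' => by
      rw [← Complex.conj_re (conj (a x') * a x), map_mul, Complex.conj_conj, mul_comm]
    have h2 : 2 * ∑ x ∈ B, ∑ x' ∈ B, M x x' = ∑ x ∈ B, ∑ x' ∈ B, (M x x' + M x' x) := by
      rw [two_mul]
      nth_rw 1 [hswap]
      rw [← sum_add_distrib]
      refine sum_congr rfl fun x _ => ?_
      rw [← sum_add_distrib]
      exact sum_congr rfl fun x' _ => by ring
    have h3 : ∑ x ∈ B, ∑ x' ∈ B, (M x x' + M x' x) = ∑ x ∈ B, ∑ x' ∈ B, (-((ω x - ω x') ^ 2 * (conj (a x) * a x').re)) := by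
      refine sum_congr rfl fun x _ => sum_congr rfl fun x' _ => ?_
      simp only [hM]
      rw [hre x x']
      ring
    rw [h3] at h2
    have h4 : ∑ x ∈ B, ∑ x' ∈ B, (-(1 / 2 : ℝ)) * ((ω x - ω x') ^ 2 * (conj (a x) * a x').re) =
        (1 / 2 : ℝ) * ∑ x ∈ B, ∑ x' ∈ B, (-((ω x - ω x') ^ 2 * (conj (a x) * a x').re)) := by
      rw [mul_sum]
      refine sum_congr rfl fun x _ => ?_
      rw [mul_sum]
      exact sum_congr rfl fun x' _ => by ring
    rw [h4, ← h2]
    ring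
  rw [hsym]
  -- bound each term
  calc ∑ x ∈ B, ∑ x' ∈ B, (-(1 / 2 : ℝ)) * ((ω x - ω x') ^ 2 * (conj (a x) * a x').re)
      ≤ ∑ x ∈ B, ∑ x' ∈ B, (1 / 2 : ℝ) * (S₂ * ((ω x * ‖a x‖) * (ω x' * ‖a x'‖))) := by
        refine sum_le_sum fun x hx => sum_le_sum fun x' hx' => ?_
        have hre : |(conj (a x) * a x').re| ≤ ‖a x‖ * ‖a x'‖ := by
          calc |(conj (a x) * a x').re| ≤ ‖conj (a x) * a x'‖ := Complex.abs_re_le_norm _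
            _ = ‖a x‖ * ‖a x'‖ := by rw [norm_mul, RCLike.norm_conj]
        have h1 : (-(1 / 2 : ℝ)) * ((ω x - ω x') ^ 2 * (conj (a x) * a x').re) ≤ (1 / 2) * ((ω x - ω x') ^ 2 * (‖a x‖ * ‖a x'‖)) := by
          have := neg_abs_le (conj (a x) * a x').re
          nlinarith [sq_nonneg (ω x - ω x'), mul_nonneg (norm_nonneg (a x)) (norm_nonneg (a x'))]
        refine h1.trans ?_
        have h2 := mul_le_mul_of_nonneg_right (hosc x hx x' hx') (mul_nonneg (norm_nonneg (a x)) (norm_nonneg (a x')))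
        nlinarith [h2]
    _ = S₂ / 2 * (∑ x ∈ B, ω x * ‖a x‖) ^ 2 := by
        rw [sq, sum_mul_sum, mul_sum]
        refine sum_congr rfl fun x _ => ?_
        rw [mul_sum]
        exact sum_congr rfl fun x' _ => by ring

/-- kernel, THE CONJUGATION DEFECT OF THE BOND TERM on the region: for a positive weight `ω` with `(ω(b₊) − ω(b₋))² ≤ S₁ω(b₊)ω(b₋)` on
`Ω*`, `Σ_{b∈Ω*}‖(D_u(ωφ))(b)‖² ≤ Re Σ_{b∈Ω*} conj((D_u(ω²φ))(b))·(D_uφ)(b) + d·c²S₁·Σ_x(ω(x)|φ(x)|)²` (`|u_b| = 1`; every site ends `d` bonds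
and starts `d` bonds). [cite: BalabanImbrieJaffe1985, (7.3.2) p.326] -/
theorem defectD_region_le (c : ℝ) (U : GaugeField P j U1) (Ω : Finset (Balaban1983to89.Site P j))
    {ω : Balaban1983to89.Site P j → ℝ} {S₁ : ℝ} (hS₁ : 0 ≤ S₁)
    (hω₁ : ∀ b ∈ starB Ω, (ω b.tgt - ω b.src) ^ 2 ≤ S₁ * (ω b.tgt * ω b.src)) (φ : Balaban1983to89.Site P j → ℂ) :
    ∑ b ∈ starB Ω, ‖covD c (cfg U) (fun x => (ω x : ℂ) * φ x) b‖ ^ 2 ≤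
      (∑ b ∈ starB Ω, conj (covD c (cfg U) (fun x => (ω x : ℂ) ^ 2 * φ x) b) * covD c (cfg U) φ b).re +
        P.d * c ^ 2 * S₁ * ∑ x, (ω x * ‖φ x‖) ^ 2 := by
  set A : ℝ := ∑ x, (ω x * ‖φ x‖) ^ 2 with hA
  rw [Complex.re_sum]
  have hpt : ∀ b ∈ starB Ω, ‖covD c (cfg U) (fun x => (ω x : ℂ) * φ x) b‖ ^ 2 ≤
      (conj (covD c (cfg U) (fun x => (ω x : ℂ) ^ 2 * φ x) b) * covD c (cfg U) φ b).re +
      c ^ 2 * (S₁ / 2) * ((ω b.tgt * ‖φ b.tgt‖) ^ 2 + (ω b.src * ‖φ b.src‖) ^ 2) := by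
    intro b hb
    have hu : ‖cfg U b‖ = 1 := norm_toC (U b)
    -- the three covariant derivatives through `A := u_bφ(b₊)`, `B := φ(b₋)`
    set Aa : ℂ := cfg U b * φ b.tgt with hAa
    set Bb : ℂ := φ b.src with hBb
    have eχ : covD c (cfg U) (fun x => (ω x : ℂ) * φ x) b = (c : ℂ) * ((ω b.tgt : ℂ) * Aa - (ω b.src : ℂ) * Bb) := by
      simp only [covD, hAa, hBb]; ring
    have eψ : covD c (cfg U) (fun x => (ω x : ℂ) ^ 2 * φ x) b = (c : ℂ) * ((ω b.tgt : ℂ) ^ 2 * Aa - (ω b.src : ℂ) ^ 2 * Bb) := by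
      simp only [covD, hAa, hBb]; ring
    have eφ : covD c (cfg U) φ b = (c : ℂ) * (Aa - Bb) := by simp only [covD, hAa, hBb]
    rw [eχ, eψ, eφ]
    have hd := bond_defect_le Aa Bb (ω b.tgt) (ω b.src)
    have hnA : ‖Aa‖ = ‖φ b.tgt‖ := by rw [hAa, norm_mul, hu, one_mul]
    rw [hnA] at hd
    have e1 : ‖(c : ℂ) * ((ω b.tgt : ℂ) * Aa - (ω b.src : ℂ) * Bb)‖ ^ 2 = c ^ 2 * ‖(ω b.tgt : ℂ) * Aa - (ω b.src : ℂ) * Bb‖ ^ 2 := by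
      rw [norm_mul, mul_pow, Complex.norm_real, Real.norm_eq_abs, sq_abs]
    have e2 : (conj ((c : ℂ) * ((ω b.tgt : ℂ) ^ 2 * Aa - (ω b.src : ℂ) ^ 2 * Bb)) * ((c : ℂ) * (Aa - Bb))).re =
        c ^ 2 * (conj ((ω b.tgt : ℂ) ^ 2 * Aa - (ω b.src : ℂ) ^ 2 * Bb) * (Aa - Bb)).re := by
      have e3 : conj ((c : ℂ) * ((ω b.tgt : ℂ) ^ 2 * Aa - (ω b.src : ℂ) ^ 2 * Bb)) * ((c : ℂ) * (Aa - Bb)) =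
          ((c ^ 2 : ℝ) : ℂ) * (conj ((ω b.tgt : ℂ) ^ 2 * Aa - (ω b.src : ℂ) ^ 2 * Bb) * (Aa - Bb)) := by
        rw [map_mul, Complex.conj_ofReal]; push_cast; ring
      rw [e3, Complex.re_ofReal_mul]
    rw [e1, e2]
    have hosc := hω₁ b hb
    have hcross : (ω b.tgt - ω b.src) ^ 2 * (‖φ b.tgt‖ * ‖Bb‖) ≤
        S₁ / 2 * ((ω b.tgt * ‖φ b.tgt‖) ^ 2 + (ω b.src * ‖φ b.src‖) ^ 2) := by
      rw [hBb]
      have hab : 2 * (ω b.tgt * ‖φ b.tgt‖) * (ω b.src * ‖φ b.src‖) ≤ (ω b.tgt * ‖φ b.tgt‖) ^ 2 + (ω b.src * ‖φ b.src‖) ^ 2 :=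
        two_mul_le_add_sq _ _
      calc (ω b.tgt - ω b.src) ^ 2 * (‖φ b.tgt‖ * ‖φ b.src‖)
          ≤ S₁ * (ω b.tgt * ω b.src) * (‖φ b.tgt‖ * ‖φ b.src‖) :=
            mul_le_mul_of_nonneg_right hosc (mul_nonneg (norm_nonneg _) (norm_nonneg _))
        _ = S₁ / 2 * (2 * (ω b.tgt * ‖φ b.tgt‖) * (ω b.src * ‖φ b.src‖)) := by ring
        _ ≤ S₁ / 2 * ((ω b.tgt * ‖φ b.tgt‖) ^ 2 + (ω b.src * ‖φ b.src‖) ^ 2) := mul_le_mul_of_nonneg_left hab (by positivity)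
    have hc2 : 0 ≤ c ^ 2 := sq_nonneg c
    have h4 := mul_le_mul_of_nonneg_left (hd.trans (add_le_add le_rfl hcross)) hc2
    calc c ^ 2 * ‖(ω b.tgt : ℂ) * Aa - (ω b.src : ℂ) * Bb‖ ^ 2
        ≤ c ^ 2 * ((conj ((ω b.tgt : ℂ) ^ 2 * Aa - (ω b.src : ℂ) ^ 2 * Bb) * (Aa - Bb)).re +
            S₁ / 2 * ((ω b.tgt * ‖φ b.tgt‖) ^ 2 + (ω b.src * ‖φ b.src‖) ^ 2)) := h4
      _ = _ := by ring
  refine (sum_le_sum hpt).trans ?_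
  rw [sum_add_distrib, ← mul_sum]
  have ht : ∑ b : PBond P j, (ω b.tgt * ‖φ b.tgt‖) ^ 2 = P.d * A := by
    rw [BIJ85BlockAveragingIneq.sum_bond_eq, hA]
    exact BIJ85BlockAveragingIneq.sum_sum_shift_dir (fun x => (ω x * ‖φ x‖) ^ 2)
  have hs' : ∑ b : PBond P j, (ω b.src * ‖φ b.src‖) ^ 2 = P.d * A := by
    rw [BIJ85BlockAveragingIneq.sum_bond_eq, hA, mul_sum]
    refine sum_congr rfl fun x _ => ?_
    show ∑ μ : Fin P.d, (ω x * ‖φ x‖) ^ 2 = (P.d : ℝ) * (ω x * ‖φ x‖) ^ 2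
    rw [sum_const, card_univ, Fintype.card_fin, nsmul_eq_mul]
  have hsum : ∑ b ∈ starB Ω, ((ω b.tgt * ‖φ b.tgt‖) ^ 2 + (ω b.src * ‖φ b.src‖) ^ 2) ≤ 2 * P.d * A := by
    calc ∑ b ∈ starB Ω, ((ω b.tgt * ‖φ b.tgt‖) ^ 2 + (ω b.src * ‖φ b.src‖) ^ 2)
        ≤ ∑ b : PBond P j, ((ω b.tgt * ‖φ b.tgt‖) ^ 2 + (ω b.src * ‖φ b.src‖) ^ 2) :=
          sum_le_sum_of_subset_of_nonneg (subset_univ _) fun _ _ _ => by positivity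
      _ = P.d * A + P.d * A := by rw [sum_add_distrib, ht, hs']
      _ = 2 * P.d * A := by ring
  have hc2 : 0 ≤ c ^ 2 * (S₁ / 2) := by positivity
  have h5 := mul_le_mul_of_nonneg_left hsum hc2
  have e : c ^ 2 * (S₁ / 2) * (2 * P.d * A) = P.d * c ^ 2 * S₁ * A := by ring
  rw [e] at h5
  exact add_le_add le_rfl h5

/-- kernel, THE CONJUGATION DEFECT OF THE BLOCK TERM on the region: for a positive weight `ω` with `(ω(x) − ω(x′))² ≤ S₂ω(x)ω(x′)` inside
`k`-blocks, `Σ_{B^k(y)⊆Ω}‖(Q_k(u)(ωφ))(y)‖² ≤ Re Σ_{B^k(y)⊆Ω} conj((Q_k(u)(ω²φ))(y))·(Q_k(u)φ)(y) + (S₂/(2N))·Σ_x(ω(x)|φ(x)|)²` (`|u(Γ)| = 1`,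
`|B^k(y)| = N = L^{kd}`). [cite: BalabanImbrieJaffe1985, (7.3.2) p.326] -/
theorem defectQ_region_le {k : ℕ} (hk : j + k ≤ P.m + P.K) (U : GaugeField P j U1) (Ω : Finset (Balaban1983to89.Site P j))
    {ω : Balaban1983to89.Site P j → ℝ} {S₂ : ℝ} (hS₂ : 0 ≤ S₂)
    (hω₂ : ∀ x x' : Balaban1983to89.Site P j, blkIter k x = blkIter k x' → (ω x - ω x') ^ 2 ≤ S₂ * (ω x * ω x'))
    (φ : Balaban1983to89.Site P j → ℂ) :
    ∑ y ∈ innerK k Ω, ‖qCovK U k (fun x => (ω x : ℂ) * φ x) y‖ ^ 2 ≤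
      (∑ y ∈ innerK k Ω, conj (qCovK U k (fun x => (ω x : ℂ) ^ 2 * φ x) y) * qCovK U k φ y).re +
        S₂ / (2 * (P.L : ℝ) ^ (k * P.d)) * ∑ x, (ω x * ‖φ x‖) ^ 2 := by
  set A : ℝ := ∑ x, (ω x * ‖φ x‖) ^ 2 with hA
  set N : ℝ := (P.L : ℝ) ^ (k * P.d) with hNdef
  have hNpos : 0 < N := pow_pos P.cast_L_pos _
  rw [Complex.re_sum]
  have hpt : ∀ y ∈ innerK k Ω, ‖qCovK U k (fun x => (ω x : ℂ) * φ x) y‖ ^ 2 ≤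
      (conj (qCovK U k (fun x => (ω x : ℂ) ^ 2 * φ x) y) * qCovK U k φ y).re +
      S₂ / (2 * N) * ∑ x ∈ blockK k y, (ω x * ‖φ x‖) ^ 2 := by
    intro y _
    set Bk := blockK k y with hBk
    set av : Balaban1983to89.Site P j → ℂ := fun x => holCK U k x * φ x with hav
    have hNc : ((P.L : ℂ) ^ (k * P.d))⁻¹ = ((N⁻¹ : ℝ) : ℂ) := by rw [hNdef]; push_cast; rfl
    have eχ : qCovK U k (fun x => (ω x : ℂ) * φ x) y = ((N⁻¹ : ℝ) : ℂ) * ∑ x ∈ Bk, (ω x : ℂ) * av x := by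
      rw [qCovK_apply, hNc]; congr 1; exact sum_congr rfl fun x _ => by simp only [hav]; ring
    have eψ : qCovK U k (fun x => (ω x : ℂ) ^ 2 * φ x) y = ((N⁻¹ : ℝ) : ℂ) * ∑ x ∈ Bk, (ω x : ℂ) ^ 2 * av x := by
      rw [qCovK_apply, hNc]; congr 1; exact sum_congr rfl fun x _ => by simp only [hav]; ring
    have eφ : qCovK U k φ y = ((N⁻¹ : ℝ) : ℂ) * ∑ x ∈ Bk, av x := by
      rw [qCovK_apply, hNc]
    rw [eχ, eψ, eφ]
    have hnav : ∀ x, ‖av x‖ = ‖φ x‖ := fun x => by rw [hav, norm_mul, norm_holCK, one_mul]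
    have hd := block_defect_le Bk av ω (S₂ := S₂) (fun x hx x' hx' =>
      hω₂ x x' (by rw [mem_blockK.1 hx, mem_blockK.1 hx']))
    simp_rw [hnav] at hd
    have e1 : ‖((N⁻¹ : ℝ) : ℂ) * ∑ x ∈ Bk, (ω x : ℂ) * av x‖ ^ 2 = N⁻¹ ^ 2 * ‖∑ x ∈ Bk, (ω x : ℂ) * av x‖ ^ 2 := by
      rw [norm_mul, mul_pow, Complex.norm_real, Real.norm_of_nonneg (inv_nonneg.2 hNpos.le)]
    have e2 : (conj (((N⁻¹ : ℝ) : ℂ) * ∑ x ∈ Bk, (ω x : ℂ) ^ 2 * av x) * (((N⁻¹ : ℝ) : ℂ) * ∑ x ∈ Bk, av x)).re =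
        N⁻¹ ^ 2 * (conj (∑ x ∈ Bk, (ω x : ℂ) ^ 2 * av x) * ∑ x ∈ Bk, av x).re := by
      have e3 : conj (((N⁻¹ : ℝ) : ℂ) * ∑ x ∈ Bk, (ω x : ℂ) ^ 2 * av x) * (((N⁻¹ : ℝ) : ℂ) * ∑ x ∈ Bk, av x) =
          ((N⁻¹ ^ 2 : ℝ) : ℂ) * (conj (∑ x ∈ Bk, (ω x : ℂ) ^ 2 * av x) * ∑ x ∈ Bk, av x) := by
        rw [map_mul, Complex.conj_ofReal]; push_cast; ring
      rw [e3, Complex.re_ofReal_mul]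
    rw [e1, e2]
    -- Cauchy–Schwarz in the block: `(Σ ω|φ|)² ≤ N·Σ(ω|φ|)²`
    have hcs : (∑ x ∈ Bk, ω x * ‖φ x‖) ^ 2 ≤ N * ∑ x ∈ Bk, (ω x * ‖φ x‖) ^ 2 := by
      have h := sq_sum_le_card_mul_sum_sq (s := Bk) (f := fun x => ω x * ‖φ x‖)
      rw [hBk, card_blockK k hk y, Nat.cast_pow] at h
      rw [hBk]; exact h
    have hN2 : 0 ≤ N⁻¹ ^ 2 := sq_nonneg _
    have key := mul_le_mul_of_nonneg_left (hd.trans (mul_le_mul_of_nonneg_left hcs (by positivity))) hN2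
    have e3 : N⁻¹ ^ 2 * (S₂ / 2 * (N * ∑ x ∈ Bk, (ω x * ‖φ x‖) ^ 2)) = S₂ / (2 * N) * ∑ x ∈ Bk, (ω x * ‖φ x‖) ^ 2 := by
      field_simp
    rw [mul_sub, e3] at key
    linarith
  refine (sum_le_sum hpt).trans ?_
  rw [sum_add_distrib, ← mul_sum]
  have hblocks : ∑ y ∈ innerK k Ω, ∑ x ∈ blockK k y, (ω x * ‖φ x‖) ^ 2 ≤ A := by
    calc ∑ y ∈ innerK k Ω, ∑ x ∈ blockK k y, (ω x * ‖φ x‖) ^ 2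
        ≤ ∑ y : Balaban1983to89.Site P (j + k), ∑ x ∈ blockK k y, (ω x * ‖φ x‖) ^ 2 :=
          sum_le_sum_of_subset_of_nonneg (subset_univ _) fun _ _ _ => sum_nonneg fun _ _ => sq_nonneg _
      _ = A := by rw [BIJ85BlockAveragingIneq.sum_blockK_sum (k := k) (fun x => (ω x * ‖φ x‖) ^ 2)]
  have hS2N : 0 ≤ S₂ / (2 * N) := by positivity
  exact add_le_add le_rfl (mul_le_mul_of_nonneg_left hblocks hS2N)

/-- **THE AGMON–COMBES–THOMAS WEIGHTED BOUND FOR THE REGION PROPAGATOR `G_k(Ω,u)`**: for a union `Ω` of `k`-blocks, a `U(1)` field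
bondwise small inside `Ω` (`T`, `δ` with `2(n−1)nd·T² + 2δ² ≤ 1/2`), `a > 0`, `c ≠ 0`, every positive weight `ω` whose squared
oscillation is `S₁`-small across the bonds of `Ω*` and `S₂`-small inside `k`-blocks (relative to `ωω′`), with `κ = dc²S₁ + aS₂/(2N) < m₁ =
min(c²/(4n²), a/(4N))`, and every source `f`:
`Σ_x ω(x)²|(G_k(Ω,u)f)(x)|² ≤ Σ_x ω(x)²|f(x)|²/(m₁ − κ)²` — coercivity at `ωφ`, the two conjugation defects, the equation `nOp φ = 1_Ωf`
tested against `ω²φ`, Cauchy–Schwarz (p33's `agmon_weighted` for the REGION operator). [cite: BalabanImbrieJaffe1985, (7.3.2) p.326] -/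
theorem agmon_weighted_region {k : ℕ} (hk : j + k ≤ P.m + P.K) {Ω : Finset (Balaban1983to89.Site P j)} (hΩ : IsBlockUnion k Ω)
    (U : GaugeField P j U1) {T δ : ℝ}
    (hInt : ∀ b ∈ starB Ω, blkIter k b.src = blkIter k b.tgt → ‖toC (U b) - 1‖ ≤ T)
    (hTree : ∀ x ∈ Ω, ‖holCK U k x - 1‖ ≤ δ)
    (hsmall : 2 * (((P.L : ℝ) ^ k - 1) * (P.L : ℝ) ^ k) * P.d * T ^ 2 + 2 * δ ^ 2 ≤ 1 / 2)
    {c : ℝ} (hc : c ≠ 0) {a : ℝ} (ha : 0 < a)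
    {ω : Balaban1983to89.Site P j → ℝ} (hωpos : ∀ x, 0 < ω x) {S₁ S₂ : ℝ} (hS₁ : 0 ≤ S₁) (hS₂ : 0 ≤ S₂)
    (hω₁ : ∀ b ∈ starB Ω, (ω b.tgt - ω b.src) ^ 2 ≤ S₁ * (ω b.tgt * ω b.src))
    (hω₂ : ∀ x x' : Balaban1983to89.Site P j, blkIter k x = blkIter k x' → (ω x - ω x') ^ 2 ≤ S₂ * (ω x * ω x'))
    (hκ : P.d * c ^ 2 * S₁ + a * (S₂ / (2 * (P.L : ℝ) ^ (k * P.d)))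
      < min (c ^ 2 / (4 * ((P.L : ℝ) ^ k) ^ 2)) (a / (4 * (P.L : ℝ) ^ (k * P.d))))
    (f : Balaban1983to89.Site P j → ℂ) :
    ∑ x, (ω x * ‖(gBox a c U k Ω *ᵥ f) x‖) ^ 2 ≤
      (∑ x, (ω x * ‖f x‖) ^ 2) /
        (min (c ^ 2 / (4 * ((P.L : ℝ) ^ k) ^ 2)) (a / (4 * (P.L : ℝ) ^ (k * P.d)))
          - (P.d * c ^ 2 * S₁ + a * (S₂ / (2 * (P.L : ℝ) ^ (k * P.d))))) ^ 2 := by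
  classical
  set m₁ : ℝ := min (c ^ 2 / (4 * ((P.L : ℝ) ^ k) ^ 2)) (a / (4 * (P.L : ℝ) ^ (k * P.d))) with hm₁
  set κ : ℝ := P.d * c ^ 2 * S₁ + a * (S₂ / (2 * (P.L : ℝ) ^ (k * P.d))) with hκdef
  set φ : Balaban1983to89.Site P j → ℂ := gBox a c U k Ω *ᵥ f with hφ
  have hφ0 : ∀ x, x ∉ Ω → φ x = 0 := fun x hx => gBox_mulVec_eq_zero_of_not_mem hk hc ha U hΩ f hx
  -- the weighted fields (kept as explicit lambdas)
  have hχ0 : ∀ x, x ∉ Ω → (fun x => (ω x : ℂ) * φ x) x = 0 := fun x hx => by simp only [hφ0 x hx, mul_zero]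
  set A : ℝ := ∑ x, (ω x * ‖φ x‖) ^ 2 with hA
  set B : ℝ := ∑ x, (ω x * ‖f x‖) ^ 2 with hB
  have hA0 : 0 ≤ A := sum_nonneg fun _ _ => sq_nonneg _
  have hB0 : 0 ≤ B := sum_nonneg fun _ _ => sq_nonneg _
  have hAχ : ∑ x, ‖(fun x => (ω x : ℂ) * φ x) x‖ ^ 2 = A :=
    sum_congr rfl fun x _ => by simp only [norm_mul, Complex.norm_real, Real.norm_of_nonneg (hωpos x).le]
  -- (1) coercivity at `χ = ωφ`
  have h1 : m₁ * A ≤ (star (fun x => (ω x : ℂ) * φ x) ⬝ᵥ (nOp a c U k Ω *ᵥ fun x => (ω x : ℂ) * φ x)).re := by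
    rw [← hAχ]; exact coercive_region hk hΩ U hInt hTree hsmall c ha _ hχ0
  rw [re_form_nOp_self] at h1
  -- (2) the pairing `Re ψᴴ(nOp φ) = Re Σ_{x∈Ω} ω²conj(φ)f ≤ √A√B`, `ψ = ω²φ`
  have h2 : (star (fun x => (ω x : ℂ) ^ 2 * φ x) ⬝ᵥ (nOp a c U k Ω *ᵥ φ)).re ≤ Real.sqrt A * Real.sqrt B := by
    rw [hφ, nOp_mulVec_gBox_mulVec hk hc ha U hΩ]
    have e : (star (fun x => (ω x : ℂ) ^ 2 * (gBox a c U k Ω *ᵥ f) x) ⬝ᵥ (proj Ω *ᵥ f)).re =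
        ∑ x, ((conj ((ω x : ℂ) ^ 2 * (gBox a c U k Ω *ᵥ f) x)) * (if x ∈ Ω then f x else 0)).re := by
      simp only [dotProduct, Pi.star_apply, proj_mulVec, Complex.re_sum, Complex.star_def]
    rw [e, ← hφ]
    have hpt : ∀ x, ((conj ((ω x : ℂ) ^ 2 * φ x)) * (if x ∈ Ω then f x else 0)).re ≤ (ω x * ‖φ x‖) * (ω x * ‖f x‖) := by
      intro x
      refine (Complex.re_le_norm _).trans ?_
      rw [norm_mul, RCLike.norm_conj, norm_mul, norm_pow, Complex.norm_real, Real.norm_of_nonneg (hωpos x).le]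
      split_ifs
      · nlinarith [norm_nonneg (φ x), norm_nonneg (f x), (hωpos x).le]
      · rw [norm_zero, mul_zero]; exact mul_nonneg (mul_nonneg (hωpos x).le (norm_nonneg _)) (mul_nonneg (hωpos x).le (norm_nonneg _))
    refine (sum_le_sum fun x _ => hpt x).trans ?_
    have hcs := sum_mul_sq_le_sq_mul_sq univ (fun x => ω x * ‖φ x‖) (fun x => ω x * ‖f x‖)
    rw [← Real.sqrt_mul hA0]
    refine Real.le_sqrt_of_sq_le ?_
    rw [hA, hB]
    exact hcs
  rw [form_nOp_eq] at h2
  -- (3) the two defects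
  have h3a := defectD_region_le c U Ω hS₁ hω₁ φ
  have h3b := defectQ_region_le hk U Ω hS₂ hω₂ φ
  rw [← hA] at h3a h3b
  -- (4) assemble: `(m₁ − κ)A ≤ √A√B`
  have hpos : 0 < m₁ - κ := sub_pos.2 hκ
  have h5 : (m₁ - κ) * A ≤ Real.sqrt A * Real.sqrt B := by
    have hre : (∑ b ∈ starB Ω, conj (covD c (cfg U) (fun x => (ω x : ℂ) ^ 2 * φ x) b) * covD c (cfg U) φ b +
          (a : ℂ) * ∑ y ∈ innerK k Ω, conj (qCovK U k (fun x => (ω x : ℂ) ^ 2 * φ x) y) * qCovK U k φ y).re =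
        (∑ b ∈ starB Ω, conj (covD c (cfg U) (fun x => (ω x : ℂ) ^ 2 * φ x) b) * covD c (cfg U) φ b).re +
          a * (∑ y ∈ innerK k Ω, conj (qCovK U k (fun x => (ω x : ℂ) ^ 2 * φ x) y) * qCovK U k φ y).re := by
      rw [Complex.add_re, Complex.re_ofReal_mul]
    rw [hre] at h2
    have h3b' := mul_le_mul_of_nonneg_left h3b ha.le
    have e : κ * A = P.d * c ^ 2 * S₁ * A + a * (S₂ / (2 * (P.L : ℝ) ^ (k * P.d)) * A) := by rw [hκdef]; ring
    nlinarith [h1, h2, h3a, h3b', e]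
  have h6 : (m₁ - κ) * Real.sqrt A ≤ Real.sqrt B := by
    by_cases hAz : Real.sqrt A = 0
    · rw [hAz, mul_zero]; exact Real.sqrt_nonneg _
    · have hApos : 0 < Real.sqrt A := lt_of_le_of_ne (Real.sqrt_nonneg _) (Ne.symm hAz)
      have e : (m₁ - κ) * A = ((m₁ - κ) * Real.sqrt A) * Real.sqrt A := by rw [mul_assoc, Real.mul_self_sqrt hA0]
      rw [e, mul_comm (Real.sqrt A) (Real.sqrt B)] at h5
      exact le_of_mul_le_mul_right h5 hApos
  have h7 : ((m₁ - κ) * Real.sqrt A) ^ 2 ≤ (Real.sqrt B) ^ 2 := pow_le_pow_left₀ (mul_nonneg hpos.le (Real.sqrt_nonneg _)) h6 2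
  rw [mul_pow, Real.sq_sqrt hA0, Real.sq_sqrt hB0] at h7
  rw [le_div_iff₀ (pow_pos hpos 2)]
  linarith

/-! ## §4 The exponential weight `e^{s|x₀−·|_∞/L^k}` and the `k`-uniform kernel decay of `G_k(Ω,u)` at non-flat small fields -/

/-- kernel: one bond changes the `ℓ^∞` torus distance to a fixed site by at most `1` (any level). [cite: BalabanImbrieJaffe1985, (7.3.2) p.326] -/
theorem abs_supDist_tgt_sub_src_le (x₀ : Balaban1983to89.Site P j) (b : PBond P j) :
    |(supDist x₀ b.tgt : ℝ) - supDist x₀ b.src| ≤ 1 := by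
  have hb : supDist b.src b.tgt ≤ 1 := BIJ85ScalarPropagatorDecay.supDist_src_tgt_le b
  have h1 : supDist x₀ b.tgt ≤ supDist x₀ b.src + supDist b.src b.tgt := BIJ85Ineq722Torus.supDist_triangle x₀ b.src b.tgt
  have h2 : supDist x₀ b.src ≤ supDist x₀ b.tgt + supDist b.tgt b.src := BIJ85Ineq722Torus.supDist_triangle x₀ b.tgt b.src
  rw [B3TorusRadialSums.supDist_comm b.tgt b.src] at h2
  rw [abs_sub_le_iff]
  constructor
  · have : ((supDist x₀ b.tgt : ℕ) : ℝ) ≤ (supDist x₀ b.src : ℕ) + (supDist b.src b.tgt : ℕ) := by exact_mod_cast h1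
    have : ((supDist b.src b.tgt : ℕ) : ℝ) ≤ 1 := by exact_mod_cast hb
    linarith
  · have : ((supDist x₀ b.src : ℕ) : ℝ) ≤ (supDist x₀ b.tgt : ℕ) + (supDist b.src b.tgt : ℕ) := by exact_mod_cast h2
    have : ((supDist b.src b.tgt : ℕ) : ℝ) ≤ 1 := by exact_mod_cast hb
    linarith

/-- **BOND OSCILLATION of `w(z) = e^{s|x₀−z|_∞/L^k}`, `|s| ≤ t`**: `(w(b₊) − w(b₋))² ≤ (t/L^k)²e^{t/L^k}·w(b₊)w(b₋)` (p27's `weight_bond_osc`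
for either sign of the exponent, any level). [cite: BalabanImbrieJaffe1985, (7.3.2) p.326] -/
theorem weight_bond_osc_sq {s t : ℝ} (hst : |s| ≤ t) (k : ℕ) (x₀ : Balaban1983to89.Site P j) (b : PBond P j) :
    (Real.exp (s * (supDist x₀ b.tgt : ℝ) / (P.L : ℝ) ^ k) - Real.exp (s * (supDist x₀ b.src : ℝ) / (P.L : ℝ) ^ k)) ^ 2 ≤
      (t / (P.L : ℝ) ^ k) ^ 2 * Real.exp (t / (P.L : ℝ) ^ k) *
        (Real.exp (s * (supDist x₀ b.tgt : ℝ) / (P.L : ℝ) ^ k) * Real.exp (s * (supDist x₀ b.src : ℝ) / (P.L : ℝ) ^ k)) := by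
  refine BIJ85AgmonDefect.sq_exp_sub_exp_le_of_abs_le ?_
  have hn : 0 < (P.L : ℝ) ^ k := pow_pos P.cast_L_pos k
  have ht : 0 ≤ t := (abs_nonneg s).trans hst
  rw [← sub_div, ← mul_sub, abs_div, abs_mul, abs_of_pos hn]
  refine div_le_div_of_nonneg_right ?_ hn.le
  calc |s| * |(supDist x₀ b.tgt : ℝ) - supDist x₀ b.src| ≤ t * 1 :=
        mul_le_mul hst (abs_supDist_tgt_sub_src_le x₀ b) (abs_nonneg _) ht
    _ = t := mul_one t

/-- **BLOCK OSCILLATION of `w(z) = e^{s|x₀−z|_∞/L^k}`, `|s| ≤ t`**: inside one `k`-block (`|z − z′|_∞ ≤ L^k − 1`, standing range)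
`(w(z) − w(z′))² ≤ t²e^t·w(z)w(z′)`. [cite: BalabanImbrieJaffe1985, (7.3.2) p.326] -/
theorem weight_block_osc_sq {s t : ℝ} (hst : |s| ≤ t) {k : ℕ} (hk : j + k ≤ P.m + P.K) (x₀ z z' : Balaban1983to89.Site P j)
    (hzz : blkIter k z = blkIter k z') :
    (Real.exp (s * (supDist x₀ z : ℝ) / (P.L : ℝ) ^ k) - Real.exp (s * (supDist x₀ z' : ℝ) / (P.L : ℝ) ^ k)) ^ 2 ≤
      t ^ 2 * Real.exp t * (Real.exp (s * (supDist x₀ z : ℝ) / (P.L : ℝ) ^ k) * Real.exp (s * (supDist x₀ z' : ℝ) / (P.L : ℝ) ^ k)) := by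
  refine BIJ85AgmonDefect.sq_exp_sub_exp_le_of_abs_le ?_
  have hn : 0 < (P.L : ℝ) ^ k := pow_pos P.cast_L_pos k
  have ht : 0 ≤ t := (abs_nonneg s).trans hst
  have hd1 : supDist z z' ≤ P.L ^ k := (BIJ85ScalarPropagatorDecay.supDist_le_of_blkIter_eq hk hzz).trans (Nat.sub_le _ _)
  have htri1 : supDist x₀ z ≤ supDist x₀ z' + supDist z' z := BIJ85Ineq722Torus.supDist_triangle x₀ z' z
  have htri2 : supDist x₀ z' ≤ supDist x₀ z + supDist z z' := BIJ85Ineq722Torus.supDist_triangle x₀ z z'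
  rw [B3TorusRadialSums.supDist_comm z' z] at htri1
  have habs : |(supDist x₀ z : ℝ) - supDist x₀ z'| ≤ (P.L : ℝ) ^ k := by
    have c1 : ((supDist x₀ z : ℕ) : ℝ) ≤ (supDist x₀ z' : ℕ) + (supDist z z' : ℕ) := by exact_mod_cast htri1
    have c2 : ((supDist x₀ z' : ℕ) : ℝ) ≤ (supDist x₀ z : ℕ) + (supDist z z' : ℕ) := by exact_mod_cast htri2
    have c3 : ((supDist z z' : ℕ) : ℝ) ≤ (P.L : ℝ) ^ k := by exact_mod_cast hd1
    rw [abs_sub_le_iff]; constructor <;> linarith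
  rw [← sub_div, ← mul_sub, abs_div, abs_mul, abs_of_pos hn, div_le_iff₀ hn]
  calc |s| * |(supDist x₀ z : ℝ) - supDist x₀ z'| ≤ t * (P.L : ℝ) ^ k := mul_le_mul hst habs (abs_nonneg _) ht
    _ = t * (P.L : ℝ) ^ k := rfl

/-- kernel (the Agmon gap at the parameters of record): with `c = ε⁻¹`, `a′ = α_kL^{kd}` (`α_k = a_k(L^kε)^{−2}`, `a/2 ≤ a_k ≤ a`),
`S₁ = (t/L^k)²e^{t/L^k}`, `S₂ = t²e^t`, `μ₁ = min(1/4, a/8)` and `0 ≤ t ≤ min(1, μ₁/((2d + a)e))`: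
**`m₁ − κ = min(c²/(4n²), a′/(4N)) − (dc²S₁ + a′S₂/(2N)) ≥ μ₁/(2(L^kε)²)`**. [cite: BalabanImbrieJaffe1985, (7.3.2) p.326] -/
theorem agmon_gap_region (P : Params) {a : ℝ} (ha : 0 < a) {k : ℕ} (hk1 : 1 ≤ k) {t : ℝ} (ht0 : 0 ≤ t) (ht1 : t ≤ 1)
    (htμ : t ≤ min (1 / 4) (a / 8) / ((2 * P.d + a) * Real.exp 1)) :
    min (1 / 4) (a / 8) / (2 * P.spacing k ^ 2) ≤
      min ((P.eps⁻¹) ^ 2 / (4 * ((P.L : ℝ) ^ k) ^ 2))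
          (B1RG242Torus.α P a k * (P.L : ℝ) ^ (k * P.d) / (4 * (P.L : ℝ) ^ (k * P.d))) -
        (P.d * (P.eps⁻¹) ^ 2 * ((t / (P.L : ℝ) ^ k) ^ 2 * Real.exp (t / (P.L : ℝ) ^ k)) +
          B1RG242Torus.α P a k * (P.L : ℝ) ^ (k * P.d) * (t ^ 2 * Real.exp t / (2 * (P.L : ℝ) ^ (k * P.d)))) := by
  have hL2 : (2 : ℝ) ≤ P.L := by exact_mod_cast P.hL.2
  have hLpos : (0 : ℝ) < P.L := by linarith
  have hL1 : (1 : ℝ) < P.L := by linarith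
  have hn : 0 < (P.L : ℝ) ^ k := pow_pos hLpos k
  have hn1 : 1 ≤ (P.L : ℝ) ^ k := one_le_pow₀ hL1.le
  have hN : 0 < (P.L : ℝ) ^ (k * P.d) := pow_pos hLpos _
  have hε : 0 < P.eps := P.eps_pos
  have hsp : 0 < P.spacing k := P.spacing_pos k
  have hspdef : P.spacing k = (P.L : ℝ) ^ k * P.eps := rfl
  have haS0 : 0 < B1.aSeq a P.L k := B1.aSeq_pos ha hL1 hk1
  have haSle : B1.aSeq a P.L k ≤ a := B1.aSeq_le ha hL1 k hk1
  have haSge : a / 2 ≤ B1.aSeq a P.L k := BIJ85ScalarPropagatorSupDecay.aSeq_ge_half ha hL2 hk1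
  have hd0 : (0 : ℝ) ≤ P.d := Nat.cast_nonneg _
  rw [show B1RG242Torus.α P a k = B1.aSeq a P.L k * (P.spacing k ^ 2)⁻¹ from rfl]
  set μ₁ : ℝ := min (1 / 4) (a / 8) with hμ₁
  have hμ₁q : μ₁ ≤ 1 / 4 := min_le_left _ _
  have hμ₁a : μ₁ ≤ a / 8 := min_le_right _ _
  have hμ₁pos : 0 < μ₁ := lt_min (by norm_num) (by positivity)
  set sp : ℝ := P.spacing k with hspname
  set n : ℝ := (P.L : ℝ) ^ k with hnname
  set N : ℝ := (P.L : ℝ) ^ (k * P.d) with hNname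
  set aS : ℝ := B1.aSeq a P.L k with haSname
  have hsp2 : 0 < sp ^ 2 := pow_pos hsp 2
  -- (i) the mass from below
  have hm : μ₁ / sp ^ 2 ≤ min ((P.eps⁻¹) ^ 2 / (4 * n ^ 2)) (aS * (sp ^ 2)⁻¹ * N / (4 * N)) := by
    rw [le_min_iff]
    constructor
    · rw [show (P.eps⁻¹) ^ 2 / (4 * n ^ 2) = (1 / 4) / sp ^ 2 by rw [hspdef]; field_simp]
      exact div_le_div_of_nonneg_right hμ₁q hsp2.le
    · rw [show aS * (sp ^ 2)⁻¹ * N / (4 * N) = (aS / 4) / sp ^ 2 by field_simp]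
      exact div_le_div_of_nonneg_right (by linarith) hsp2.le
  -- (ii) the defect from above
  have he1 : Real.exp (t / n) ≤ Real.exp 1 := Real.exp_le_exp.2 ((div_le_self ht0 hn1).trans ht1)
  have he2 : Real.exp t ≤ Real.exp 1 := Real.exp_le_exp.2 ht1
  have ht2 : t ^ 2 ≤ t := by nlinarith
  have hκ1 : P.d * (P.eps⁻¹) ^ 2 * ((t / n) ^ 2 * Real.exp (t / n)) ≤ P.d * Real.exp 1 * t / sp ^ 2 := by
    rw [show P.d * (P.eps⁻¹) ^ 2 * ((t / n) ^ 2 * Real.exp (t / n)) = P.d * (t ^ 2 * Real.exp (t / n)) / sp ^ 2 by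
      rw [hspdef]; field_simp]
    refine div_le_div_of_nonneg_right ?_ hsp2.le
    have h : t ^ 2 * Real.exp (t / n) ≤ t * Real.exp 1 := mul_le_mul ht2 he1 (Real.exp_pos _).le ht0
    nlinarith [mul_le_mul_of_nonneg_left h hd0]
  have hκ2 : aS * (sp ^ 2)⁻¹ * N * (t ^ 2 * Real.exp t / (2 * N)) ≤ a * Real.exp 1 * t / 2 / sp ^ 2 := by
    rw [show aS * (sp ^ 2)⁻¹ * N * (t ^ 2 * Real.exp t / (2 * N)) = aS * (t ^ 2 * Real.exp t) / 2 / sp ^ 2 by field_simp]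
    refine div_le_div_of_nonneg_right (div_le_div_of_nonneg_right ?_ zero_le_two) hsp2.le
    have h : t ^ 2 * Real.exp t ≤ t * Real.exp 1 := mul_le_mul ht2 he2 (Real.exp_pos _).le ht0
    calc aS * (t ^ 2 * Real.exp t) ≤ aS * (t * Real.exp 1) := mul_le_mul_of_nonneg_left h haS0.le
      _ ≤ a * (t * Real.exp 1) := mul_le_mul_of_nonneg_right haSle (by positivity)
      _ = a * Real.exp 1 * t := by ring
  have ht3 : t * (Real.exp 1 * (2 * P.d + a)) ≤ μ₁ := by
    have hpos : 0 < (2 * (P.d : ℝ) + a) * Real.exp 1 := by positivity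
    have h := (le_div_iff₀ hpos).1 htμ
    linarith [h, show t * (Real.exp 1 * (2 * P.d + a)) = t * ((2 * P.d + a) * Real.exp 1) by ring]
  have hκ : P.d * (P.eps⁻¹) ^ 2 * ((t / n) ^ 2 * Real.exp (t / n)) + aS * (sp ^ 2)⁻¹ * N * (t ^ 2 * Real.exp t / (2 * N)) ≤
      μ₁ / (2 * sp ^ 2) := by
    calc P.d * (P.eps⁻¹) ^ 2 * ((t / n) ^ 2 * Real.exp (t / n)) + aS * (sp ^ 2)⁻¹ * N * (t ^ 2 * Real.exp t / (2 * N))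
        ≤ P.d * Real.exp 1 * t / sp ^ 2 + a * Real.exp 1 * t / 2 / sp ^ 2 := add_le_add hκ1 hκ2
      _ = t * (Real.exp 1 * (2 * P.d + a)) / 2 / sp ^ 2 := by ring
      _ ≤ μ₁ / 2 / sp ^ 2 := div_le_div_of_nonneg_right (div_le_div_of_nonneg_right ht3 zero_le_two) hsp2.le
      _ = μ₁ / (2 * sp ^ 2) := by rw [div_div]
  have e : μ₁ / sp ^ 2 - μ₁ / (2 * sp ^ 2) = μ₁ / (2 * sp ^ 2) := by field_simp; ring
  linarith [hm, hκ]

/-- **p. 262–263 / [I] p. 326: THE `k`-UNIFORM KERNEL DECAY OF THE REGION NEUMANN PROPAGATOR AT NON-FLAT SMALL FIELDS** — for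
`G_k(Ω,u) = gBox (α_kL^{kd}) ε⁻¹ u k Ω`, gen 15's propagator of record with Neumann conditions on a union `Ω` of `k`-blocks of the
fine torus: there are `t₀, c₀ > 0` depending on `(d, a)` only such that for every volume with `P.d = d`, every `1 ≤ k ≤ m + K`, every
union `Ω` of `k`-blocks, every `U(1)` field `u` with `|u_b − 1| ≤ T` on the bonds of `Ω*` inside one `k`-block and `|u(Γ^{(k)}_{x_k,x}) − 1|
≤ δ` on `Ω`, `2(L^k−1)L^k·d·T² + 2δ² ≤ 1/2`, and all `x, y`:
`|G_k(Ω,u; x, y)| ≤ c₀(L^kε)²e^{−t₀|x−y|_∞/L^k}` (the `|G(x,y)| ≤ Ae^{−c·dist}` input shape of p02's (2.30) hence-step, `k`-uniform `A`,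
decay on the block scale `L^k` = [6]'s `ξ`-distance). Mechanism: §3 at the weight `e^{t₀|y−·|_∞/L^k}` and the source `δ_y`.
[cite: BalabanImbrieJaffe1988, (2.30) p.263] -/
theorem decay_kernel_smallField_region (d : ℕ) {a : ℝ} (ha : 0 < a) :
    ∃ t₀ c₀ : ℝ, 0 < t₀ ∧ 0 < c₀ ∧ ∀ (P : Params), P.d = d →
      ∀ k : ℕ, 1 ≤ k → k ≤ P.m + P.K → ∀ (Ω : Finset (Balaban1983to89.Site P 0)), IsBlockUnion k Ω →
        ∀ (U : GaugeField P 0 U1) (T δ : ℝ),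
          (∀ b ∈ starB Ω, blkIter k b.src = blkIter k b.tgt → ‖toC (U b) - 1‖ ≤ T) →
          (∀ x ∈ Ω, ‖holCK U k x - 1‖ ≤ δ) →
          2 * (((P.L : ℝ) ^ k - 1) * (P.L : ℝ) ^ k) * P.d * T ^ 2 + 2 * δ ^ 2 ≤ 1 / 2 →
          ∀ x y : Balaban1983to89.Site P 0,
            ‖gBox (B1RG242Torus.α P a k * (P.L : ℝ) ^ (k * P.d)) P.eps⁻¹ U k Ω x y‖ ≤
              c₀ * P.spacing k ^ 2 * Real.exp (-(t₀ * (supDist x y : ℝ) / (P.L : ℝ) ^ k)) := by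
  set μ₁ : ℝ := min (1 / 4) (a / 8) with hμ₁
  have hμ₁pos : 0 < μ₁ := lt_min (by norm_num) (by positivity)
  set t : ℝ := min 1 (μ₁ / ((2 * d + a) * Real.exp 1)) with htdef
  have htpos : 0 < t := lt_min one_pos (by positivity)
  have ht1 : t ≤ 1 := min_le_left _ _
  have htμ : t ≤ μ₁ / ((2 * d + a) * Real.exp 1) := min_le_right _ _
  refine ⟨t, 2 / μ₁, htpos, by positivity, ?_⟩
  intro P hPd k hk1 hk Ω hΩ U T δ hInt hTree hsmall x y
  subst hPd
  have hk0 : 0 + k ≤ P.m + P.K := by omega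
  have hLpos : (0 : ℝ) < P.L := P.cast_L_pos
  have hL1 : (1 : ℝ) < P.L := B1RG242Torus.one_lt_cast_L P
  have hn : 0 < (P.L : ℝ) ^ k := pow_pos hLpos k
  have hN : 0 < (P.L : ℝ) ^ (k * P.d) := pow_pos hLpos _
  have hsp : 0 < P.spacing k := P.spacing_pos k
  have hα : 0 < B1RG242Torus.α P a k := mul_pos (B1.aSeq_pos ha hL1 hk1) (inv_pos.2 (pow_pos hsp 2))
  have ha' : 0 < B1RG242Torus.α P a k * (P.L : ℝ) ^ (k * P.d) := mul_pos hα hN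
  have hc : P.eps⁻¹ ≠ 0 := inv_ne_zero P.eps_pos.ne'
  -- the weight centred at the source point `y`
  set ω : Balaban1983to89.Site P 0 → ℝ := fun z => Real.exp (t * (supDist y z : ℝ) / (P.L : ℝ) ^ k) with hω
  have hωpos : ∀ z, 0 < ω z := fun z => Real.exp_pos _
  have hst : |t| ≤ t := (abs_of_pos htpos).le
  have hω₁ : ∀ b ∈ starB Ω, (ω b.tgt - ω b.src) ^ 2 ≤
      ((t / (P.L : ℝ) ^ k) ^ 2 * Real.exp (t / (P.L : ℝ) ^ k)) * (ω b.tgt * ω b.src) := fun b _ => weight_bond_osc_sq hst k y b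
  have hω₂ : ∀ z z' : Balaban1983to89.Site P 0, blkIter k z = blkIter k z' →
      (ω z - ω z') ^ 2 ≤ (t ^ 2 * Real.exp t) * (ω z * ω z') := fun z z' hzz => weight_block_osc_sq hst hk0 y z z' hzz
  -- the gap
  have hge := agmon_gap_region P ha hk1 htpos.le ht1 htμ
  have hν : 0 < μ₁ / (2 * P.spacing k ^ 2) := by positivity
  have hκ := sub_pos.1 (lt_of_lt_of_le hν hge)
  -- §3 with the source `δ_y`
  have hAg := agmon_weighted_region hk0 hΩ U hInt hTree hsmall hc ha' hωpos (by positivity) (by positivity) hω₁ hω₂ hκ (Pi.single y 1)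
  set D : ℝ := min ((P.eps⁻¹) ^ 2 / (4 * ((P.L : ℝ) ^ k) ^ 2))
      (B1RG242Torus.α P a k * (P.L : ℝ) ^ (k * P.d) / (4 * (P.L : ℝ) ^ (k * P.d))) -
    (P.d * (P.eps⁻¹) ^ 2 * ((t / (P.L : ℝ) ^ k) ^ 2 * Real.exp (t / (P.L : ℝ) ^ k)) +
      B1RG242Torus.α P a k * (P.L : ℝ) ^ (k * P.d) * (t ^ 2 * Real.exp t / (2 * (P.L : ℝ) ^ (k * P.d)))) with hDdef
  have hDpos : 0 < D := lt_of_lt_of_le hν hge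
  -- the source side: `Σ_z (ω z‖δ_y z‖)² = 1`
  have hB : ∑ z, (ω z * ‖(Pi.single y (1 : ℂ) : Balaban1983to89.Site P 0 → ℂ) z‖) ^ 2 = 1 := by
    rw [Finset.sum_eq_single y]
    · simp [hω, B3TorusRadialSums.supDist_eq_zero_iff]
    · intro z _ hz; simp [hz]
    · exact fun h => absurd (mem_univ _) h
  rw [hB] at hAg
  -- the field side: the single term at `x`
  have hφx : (gBox (B1RG242Torus.α P a k * (P.L : ℝ) ^ (k * P.d)) P.eps⁻¹ U k Ω *ᵥ (Pi.single y 1 : Balaban1983to89.Site P 0 → ℂ)) x =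
      gBox (B1RG242Torus.α P a k * (P.L : ℝ) ^ (k * P.d)) P.eps⁻¹ U k Ω x y := by
    rw [mulVec_single_one, col_apply]
  have hAx : (ω x * ‖gBox (B1RG242Torus.α P a k * (P.L : ℝ) ^ (k * P.d)) P.eps⁻¹ U k Ω x y‖) ^ 2 ≤ 1 / D ^ 2 := by
    refine le_trans ?_ hAg
    rw [← hφx]
    exact Finset.single_le_sum (f := fun z => (ω z *
      ‖(gBox (B1RG242Torus.α P a k * (P.L : ℝ) ^ (k * P.d)) P.eps⁻¹ U k Ω *ᵥ (Pi.single y 1 : Balaban1983to89.Site P 0 → ℂ)) z‖) ^ 2)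
      (fun z _ => sq_nonneg _) (mem_univ x)
  -- `ω x·|G(x,y)| ≤ 1/D ≤ 2sp²/μ₁`
  have h1 : ω x * ‖gBox (B1RG242Torus.α P a k * (P.L : ℝ) ^ (k * P.d)) P.eps⁻¹ U k Ω x y‖ ≤ 1 / D := by
    have h0 : 0 ≤ ω x * ‖gBox (B1RG242Torus.α P a k * (P.L : ℝ) ^ (k * P.d)) P.eps⁻¹ U k Ω x y‖ :=
      mul_nonneg (hωpos x).le (norm_nonneg _)
    exact (pow_le_pow_iff_left₀ h0 (by positivity) two_ne_zero).1 (hAx.trans_eq (by rw [div_pow, one_pow]))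
  have h2 : 1 / D ≤ 2 * P.spacing k ^ 2 / μ₁ := by
    rw [div_le_div_iff₀ hDpos hμ₁pos, one_mul]
    have := (div_le_iff₀ (by positivity : (0 : ℝ) < 2 * P.spacing k ^ 2)).1 hge
    linarith
  have hωx : ω x = Real.exp (t * (supDist x y : ℝ) / (P.L : ℝ) ^ k) := by
    simp only [hω, B3TorusRadialSums.supDist_comm y x]
  have h3 : ‖gBox (B1RG242Torus.α P a k * (P.L : ℝ) ^ (k * P.d)) P.eps⁻¹ U k Ω x y‖ ≤ (2 * P.spacing k ^ 2 / μ₁) / ω x := by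
    rw [le_div_iff₀ (hωpos x), mul_comm]; exact h1.trans h2
  refine h3.trans (le_of_eq ?_)
  rw [hωx, Real.exp_neg]
  field_simp

/-- **THE `ℓ²`-SOURCE FORM**: at the same data, for every source `f` and every `x`,
`‖(G_k(Ω,u)f)(x)‖ ≤ c₀(L^kε)²·(Σ_z e^{−2t₀|x−z|_∞/L^k}‖f(z)‖²)^{1/2}` (§3 at the weight `e^{−t₀|x−·|_∞/L^k}` centred at the OUTPUT point; the
printed `‖f‖_∞` form follows with the radial sum `Σ_z e^{−2t₀|x−z|_∞/L^k} ≤ K·L^{kd}`, p27's `sum_exp_neg_supDist_scale_le`, at the price of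
`k`-uniformity — see HONEST SCOPE (i)). [cite: BalabanImbrieJaffe1988, (2.30) p.263] -/
theorem decay_ell2_smallField_region (d : ℕ) {a : ℝ} (ha : 0 < a) :
    ∃ t₀ c₀ : ℝ, 0 < t₀ ∧ 0 < c₀ ∧ ∀ (P : Params), P.d = d →
      ∀ k : ℕ, 1 ≤ k → k ≤ P.m + P.K → ∀ (Ω : Finset (Balaban1983to89.Site P 0)), IsBlockUnion k Ω →
        ∀ (U : GaugeField P 0 U1) (T δ : ℝ),
          (∀ b ∈ starB Ω, blkIter k b.src = blkIter k b.tgt → ‖toC (U b) - 1‖ ≤ T) →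
          (∀ x ∈ Ω, ‖holCK U k x - 1‖ ≤ δ) →
          2 * (((P.L : ℝ) ^ k - 1) * (P.L : ℝ) ^ k) * P.d * T ^ 2 + 2 * δ ^ 2 ≤ 1 / 2 →
          ∀ (f : Balaban1983to89.Site P 0 → ℂ) (x : Balaban1983to89.Site P 0),
            ‖(gBox (B1RG242Torus.α P a k * (P.L : ℝ) ^ (k * P.d)) P.eps⁻¹ U k Ω *ᵥ f) x‖ ≤
              c₀ * P.spacing k ^ 2 *
                Real.sqrt (∑ z, (Real.exp (-(t₀ * (supDist x z : ℝ) / (P.L : ℝ) ^ k)) * ‖f z‖) ^ 2) := by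
  set μ₁ : ℝ := min (1 / 4) (a / 8) with hμ₁
  have hμ₁pos : 0 < μ₁ := lt_min (by norm_num) (by positivity)
  set t : ℝ := min 1 (μ₁ / ((2 * d + a) * Real.exp 1)) with htdef
  have htpos : 0 < t := lt_min one_pos (by positivity)
  have ht1 : t ≤ 1 := min_le_left _ _
  have htμ : t ≤ μ₁ / ((2 * d + a) * Real.exp 1) := min_le_right _ _
  refine ⟨t, 2 / μ₁, htpos, by positivity, ?_⟩
  intro P hPd k hk1 hk Ω hΩ U T δ hInt hTree hsmall f x
  subst hPd
  have hk0 : 0 + k ≤ P.m + P.K := by omega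
  have hLpos : (0 : ℝ) < P.L := P.cast_L_pos
  have hL1 : (1 : ℝ) < P.L := B1RG242Torus.one_lt_cast_L P
  have hN : 0 < (P.L : ℝ) ^ (k * P.d) := pow_pos hLpos _
  have hsp : 0 < P.spacing k := P.spacing_pos k
  have hα : 0 < B1RG242Torus.α P a k := mul_pos (B1.aSeq_pos ha hL1 hk1) (inv_pos.2 (pow_pos hsp 2))
  have ha' : 0 < B1RG242Torus.α P a k * (P.L : ℝ) ^ (k * P.d) := mul_pos hα hN
  have hc : P.eps⁻¹ ≠ 0 := inv_ne_zero P.eps_pos.ne'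
  -- the decreasing weight centred at the output point `x`
  set ω : Balaban1983to89.Site P 0 → ℝ := fun z => Real.exp (-t * (supDist x z : ℝ) / (P.L : ℝ) ^ k) with hω
  have hωpos : ∀ z, 0 < ω z := fun z => Real.exp_pos _
  have hst : |(-t)| ≤ t := by rw [abs_neg, abs_of_pos htpos]
  have hω₁ : ∀ b ∈ starB Ω, (ω b.tgt - ω b.src) ^ 2 ≤
      ((t / (P.L : ℝ) ^ k) ^ 2 * Real.exp (t / (P.L : ℝ) ^ k)) * (ω b.tgt * ω b.src) := fun b _ => weight_bond_osc_sq hst k x b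
  have hω₂ : ∀ z z' : Balaban1983to89.Site P 0, blkIter k z = blkIter k z' →
      (ω z - ω z') ^ 2 ≤ (t ^ 2 * Real.exp t) * (ω z * ω z') := fun z z' hzz => weight_block_osc_sq hst hk0 x z z' hzz
  have hge := agmon_gap_region P ha hk1 htpos.le ht1 htμ
  have hν : 0 < μ₁ / (2 * P.spacing k ^ 2) := by positivity
  have hκ := sub_pos.1 (lt_of_lt_of_le hν hge)
  have hAg := agmon_weighted_region hk0 hΩ U hInt hTree hsmall hc ha' hωpos (by positivity) (by positivity) hω₁ hω₂ hκ f
  set D : ℝ := min ((P.eps⁻¹) ^ 2 / (4 * ((P.L : ℝ) ^ k) ^ 2))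
      (B1RG242Torus.α P a k * (P.L : ℝ) ^ (k * P.d) / (4 * (P.L : ℝ) ^ (k * P.d))) -
    (P.d * (P.eps⁻¹) ^ 2 * ((t / (P.L : ℝ) ^ k) ^ 2 * Real.exp (t / (P.L : ℝ) ^ k)) +
      B1RG242Torus.α P a k * (P.L : ℝ) ^ (k * P.d) * (t ^ 2 * Real.exp t / (2 * (P.L : ℝ) ^ (k * P.d)))) with hDdef
  have hDpos : 0 < D := lt_of_lt_of_le hν hge
  set B : ℝ := ∑ z, (ω z * ‖f z‖) ^ 2 with hBdef
  have hB0 : 0 ≤ B := sum_nonneg fun _ _ => sq_nonneg _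
  set φ := gBox (B1RG242Torus.α P a k * (P.L : ℝ) ^ (k * P.d)) P.eps⁻¹ U k Ω *ᵥ f with hφ
  have hωx : ω x = 1 := by simp [hω, (B3TorusRadialSums.supDist_eq_zero_iff x x).2 rfl]
  have hAx : ‖φ x‖ ^ 2 ≤ B / D ^ 2 := by
    refine le_trans ?_ hAg
    have := Finset.single_le_sum (f := fun z => (ω z * ‖φ z‖) ^ 2) (fun z _ => sq_nonneg _) (mem_univ x)
    rwa [hωx, one_mul] at this
  have h1 : ‖φ x‖ ≤ Real.sqrt B / D :=
    (pow_le_pow_iff_left₀ (norm_nonneg _) (by positivity) two_ne_zero).1 (hAx.trans_eq (by rw [div_pow, Real.sq_sqrt hB0]))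
  have h2 : 1 / D ≤ 2 * P.spacing k ^ 2 / μ₁ := by
    rw [div_le_div_iff₀ hDpos hμ₁pos, one_mul]
    have := (div_le_iff₀ (by positivity : (0 : ℝ) < 2 * P.spacing k ^ 2)).1 hge
    linarith
  have hωe : ∀ z, ω z = Real.exp (-(t * (supDist x z : ℝ) / (P.L : ℝ) ^ k)) := fun z => by
    simp only [hω]; congr 1; ring
  have hBe : B = ∑ z, (Real.exp (-(t * (supDist x z : ℝ) / (P.L : ℝ) ^ k)) * ‖f z‖) ^ 2 :=
    sum_congr rfl fun z _ => by rw [hωe]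
  rw [← hBe]
  calc ‖φ x‖ ≤ Real.sqrt B / D := h1
    _ = 1 / D * Real.sqrt B := by ring
    _ ≤ 2 * P.spacing k ^ 2 / μ₁ * Real.sqrt B := mul_le_mul_of_nonneg_right h2 (Real.sqrt_nonneg _)
    _ = 2 / μ₁ * P.spacing k ^ 2 * Real.sqrt B := by ring

/-! ## §5 Gauge covariance: the kernel bound at every gauge transform of a bondwise-small field -/

/-- **THE KERNEL DECAY AT EVERY GAUGE TRANSFORM `u^h` OF A FIELD BONDWISE SMALL INSIDE `Ω`** (gen 15's `gBox_gaugeAct`: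
`G_k(Ω,u^h;x,y) = h(x)G_k(Ω,u;x,y)conj h(y)`, so the modulus is gauge invariant) — in particular at the [I] (4.5.4) backgrounds
`Q^{s*}_kv·e^{iθ}` read in any gauge (print: *"by change of gauge u_k can be transformed in a local region Λ into … exp[ie_kηA], where A is
smooth and small"*). [cite: BalabanImbrieJaffe1985, (7.3.2) p.326] -/
theorem decay_kernel_smallField_region_gaugeAct (d : ℕ) {a : ℝ} (ha : 0 < a) :
    ∃ t₀ c₀ : ℝ, 0 < t₀ ∧ 0 < c₀ ∧ ∀ (P : Params), P.d = d →
      ∀ k : ℕ, 1 ≤ k → k ≤ P.m + P.K → ∀ (Ω : Finset (Balaban1983to89.Site P 0)), IsBlockUnion k Ω →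
        ∀ (U : GaugeField P 0 U1) (T δ : ℝ),
          (∀ b ∈ starB Ω, blkIter k b.src = blkIter k b.tgt → ‖toC (U b) - 1‖ ≤ T) →
          (∀ x ∈ Ω, ‖holCK U k x - 1‖ ≤ δ) →
          2 * (((P.L : ℝ) ^ k - 1) * (P.L : ℝ) ^ k) * P.d * T ^ 2 + 2 * δ ^ 2 ≤ 1 / 2 →
          ∀ (h : GaugeTransf P 0 U1) (x y : Balaban1983to89.Site P 0),
            ‖gBox (B1RG242Torus.α P a k * (P.L : ℝ) ^ (k * P.d)) P.eps⁻¹ (gaugeAct h U) k Ω x y‖ ≤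
              c₀ * P.spacing k ^ 2 * Real.exp (-(t₀ * (supDist x y : ℝ) / (P.L : ℝ) ^ k)) := by
  obtain ⟨t₀, c₀, ht₀, hc₀, H⟩ := decay_kernel_smallField_region d ha
  refine ⟨t₀, c₀, ht₀, hc₀, ?_⟩
  intro P hPd k hk1 hk Ω hΩ U T δ hInt hTree hsmall h x y
  have hk0 : 0 + k ≤ P.m + P.K := by omega
  have hL1 : (1 : ℝ) < P.L := B1RG242Torus.one_lt_cast_L P
  have hα : 0 < B1RG242Torus.α P a k := mul_pos (B1.aSeq_pos ha hL1 hk1) (inv_pos.2 (pow_pos (P.spacing_pos k) 2))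
  have ha' : 0 < B1RG242Torus.α P a k * (P.L : ℝ) ^ (k * P.d) := mul_pos hα (pow_pos P.cast_L_pos _)
  have hc : P.eps⁻¹ ≠ 0 := inv_ne_zero P.eps_pos.ne'
  rw [gBox_gaugeAct_apply hk0 hc ha' h U hΩ x y, norm_mul, norm_mul, norm_toC, one_mul, RCLike.norm_conj, norm_toC, mul_one]
  exact H P hPd k hk1 hk Ω hΩ U T δ hInt hTree hsmall x y

/-! ## §6 (2.27) `G̃_k(u)` and (2.28) `G_{k,loc}(u)` at non-flat small fields: kernel decay over any finite family of block unions -/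

section Family

/-- **KERNEL DECAY OF (2.27) `G̃_k(u) = Σ_αλ_αG_k(□_α,u)` AT NON-FLAT SMALL FIELDS** — for gen 15's `BIJ88DeltaLoc234Torus.gTilde` over ANY finite
family of regions `□_α` that are unions of `k`-blocks (the cubes of (2.27): p31's `isBlockUnion_cubeT`), ANY real weights with
`Σ_α|λ_α(x₁,x₂)| ≤ 1` (print: *"a convex combination"*), and every `U(1)` field bondwise small inside the `k`-blocks
(`|u_b − 1| ≤ T` on in-block bonds, `|u(Γ^{(k)}_{x_k,x}) − 1| ≤ δ`, `2(L^k−1)L^k·d·T² + 2δ² ≤ 1/2`; print: *"We assume that u is smooth in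
the □_α's entering the sum in (2.27)"*): `‖G̃_k(u;x₁,x₂)‖ ≤ c₀(L^kε)²e^{−t₀|x₁−x₂|_∞/L^k}` — the non-flat companion of p31's
`decay_gTilde_flat_kernel`. [cite: BalabanImbrieJaffe1988, (2.27) p.263] -/
theorem decay_gTilde_smallField_kernel (d : ℕ) {a : ℝ} (ha : 0 < a) :
    ∃ t₀ c₀ : ℝ, 0 < t₀ ∧ 0 < c₀ ∧ ∀ (P : Params), P.d = d →
      ∀ k : ℕ, 1 ≤ k → k ≤ P.m + P.K → ∀ (ι : Type) [Fintype ι] (cube : ι → Finset (Balaban1983to89.Site P 0))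
        (lam : ι → Balaban1983to89.Site P 0 → Balaban1983to89.Site P 0 → ℝ),
        (∀ α, IsBlockUnion k (cube α)) → (∀ x y, ∑ α, |lam α x y| ≤ 1) →
        ∀ (U : GaugeField P 0 U1) (T δ : ℝ),
          (∀ b : PBond P 0, blkIter k b.src = blkIter k b.tgt → ‖toC (U b) - 1‖ ≤ T) →
          (∀ x, ‖holCK U k x - 1‖ ≤ δ) →
          2 * (((P.L : ℝ) ^ k - 1) * (P.L : ℝ) ^ k) * P.d * T ^ 2 + 2 * δ ^ 2 ≤ 1 / 2 →
          ∀ x y : Balaban1983to89.Site P 0,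
            ‖gTilde (B1RG242Torus.α P a k * (P.L : ℝ) ^ (k * P.d)) P.eps⁻¹ U k cube lam x y‖ ≤
              c₀ * P.spacing k ^ 2 * Real.exp (-(t₀ * (supDist x y : ℝ) / (P.L : ℝ) ^ k)) := by
  obtain ⟨t₀, c₀, ht₀, hc₀, H⟩ := decay_kernel_smallField_region d ha
  refine ⟨t₀, c₀, ht₀, hc₀, ?_⟩
  intro P hPd k hk1 hk ι _ cube lam hcube hlam U T δ hInt hTree hsmall x y
  rw [gTilde_apply]
  have hB : ∀ α, ‖gBox (B1RG242Torus.α P a k * (P.L : ℝ) ^ (k * P.d)) P.eps⁻¹ U k (cube α) x y‖ ≤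
      c₀ * P.spacing k ^ 2 * Real.exp (-(t₀ * (supDist x y : ℝ) / (P.L : ℝ) ^ k)) := fun α =>
    H P hPd k hk1 hk (cube α) (hcube α) U T δ (fun b _ hb => hInt b hb) (fun z _ => hTree z) hsmall x y
  have hE : 0 ≤ c₀ * P.spacing k ^ 2 * Real.exp (-(t₀ * (supDist x y : ℝ) / (P.L : ℝ) ^ k)) := by positivity
  calc ‖∑ α, (lam α x y : ℂ) * gBox (B1RG242Torus.α P a k * (P.L : ℝ) ^ (k * P.d)) P.eps⁻¹ U k (cube α) x y‖
      ≤ ∑ α, ‖(lam α x y : ℂ) * gBox (B1RG242Torus.α P a k * (P.L : ℝ) ^ (k * P.d)) P.eps⁻¹ U k (cube α) x y‖ := norm_sum_le _ _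
    _ ≤ ∑ α, |lam α x y| * (c₀ * P.spacing k ^ 2 * Real.exp (-(t₀ * (supDist x y : ℝ) / (P.L : ℝ) ^ k))) := by
        refine sum_le_sum fun α _ => ?_
        rw [norm_mul, Complex.norm_real, Real.norm_eq_abs]
        exact mul_le_mul_of_nonneg_left (hB α) (abs_nonneg _)
    _ = (∑ α, |lam α x y|) * (c₀ * P.spacing k ^ 2 * Real.exp (-(t₀ * (supDist x y : ℝ) / (P.L : ℝ) ^ k))) := by
        rw [Finset.sum_mul]
    _ ≤ 1 * (c₀ * P.spacing k ^ 2 * Real.exp (-(t₀ * (supDist x y : ℝ) / (P.L : ℝ) ^ k))) :=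
        mul_le_mul_of_nonneg_right (hlam x y) hE
    _ = c₀ * P.spacing k ^ 2 * Real.exp (-(t₀ * (supDist x y : ℝ) / (P.L : ℝ) ^ k)) := one_mul _

/-- **KERNEL DECAY OF (2.28) `G_{k,loc}(u) = ζ″_kG̃_k(u)` AT NON-FLAT SMALL FIELDS** — for gen 15's `BIJ88DeltaLoc234Torus.gLocT` with ANY real
cut-off `|ζ″| ≤ 1`, regions and weights as in `decay_gTilde_smallField_kernel`: `‖G_{k,loc}(u;x₁,x₂)‖ ≤ c₀(L^kε)²e^{−t₀|x₁−x₂|_∞/L^k}` —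
the `|G(x,y)| ≤ Ae^{−c·dist}` input (`hG`) of p02's (2.30) hence-step `BIJ88OpDecay230Proof.opDecay230` for the object with body, at
non-flat `u`. [cite: BalabanImbrieJaffe1988, (2.28) p.263] -/
theorem decay_gLocT_smallField_kernel (d : ℕ) {a : ℝ} (ha : 0 < a) :
    ∃ t₀ c₀ : ℝ, 0 < t₀ ∧ 0 < c₀ ∧ ∀ (P : Params), P.d = d →
      ∀ k : ℕ, 1 ≤ k → k ≤ P.m + P.K → ∀ (ι : Type) [Fintype ι] (cube : ι → Finset (Balaban1983to89.Site P 0))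
        (lam : ι → Balaban1983to89.Site P 0 → Balaban1983to89.Site P 0 → ℝ)
        (ζ'' : Balaban1983to89.Site P 0 → Balaban1983to89.Site P 0 → ℝ),
        (∀ α, IsBlockUnion k (cube α)) → (∀ x y, ∑ α, |lam α x y| ≤ 1) → (∀ x y, |ζ'' x y| ≤ 1) →
        ∀ (U : GaugeField P 0 U1) (T δ : ℝ),
          (∀ b : PBond P 0, blkIter k b.src = blkIter k b.tgt → ‖toC (U b) - 1‖ ≤ T) →
          (∀ x, ‖holCK U k x - 1‖ ≤ δ) →
          2 * (((P.L : ℝ) ^ k - 1) * (P.L : ℝ) ^ k) * P.d * T ^ 2 + 2 * δ ^ 2 ≤ 1 / 2 →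
          ∀ x y : Balaban1983to89.Site P 0,
            ‖gLocT (B1RG242Torus.α P a k * (P.L : ℝ) ^ (k * P.d)) P.eps⁻¹ U k cube lam ζ'' x y‖ ≤
              c₀ * P.spacing k ^ 2 * Real.exp (-(t₀ * (supDist x y : ℝ) / (P.L : ℝ) ^ k)) := by
  obtain ⟨t₀, c₀, ht₀, hc₀, H⟩ := decay_gTilde_smallField_kernel d ha
  refine ⟨t₀, c₀, ht₀, hc₀, ?_⟩
  intro P hPd k hk1 hk ι _ cube lam ζ'' hcube hlam hζ U T δ hInt hTree hsmall x y
  rw [gLocT_apply, norm_mul, Complex.norm_real, Real.norm_eq_abs]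
  have h := H P hPd k hk1 hk ι cube lam hcube hlam U T δ hInt hTree hsmall x y
  have hE : 0 ≤ c₀ * P.spacing k ^ 2 * Real.exp (-(t₀ * (supDist x y : ℝ) / (P.L : ℝ) ^ k)) := by positivity
  calc |ζ'' x y| * ‖gTilde (B1RG242Torus.α P a k * (P.L : ℝ) ^ (k * P.d)) P.eps⁻¹ U k cube lam x y‖
      ≤ 1 * (c₀ * P.spacing k ^ 2 * Real.exp (-(t₀ * (supDist x y : ℝ) / (P.L : ℝ) ^ k))) :=
        mul_le_mul (hζ x y) h (norm_nonneg _) zero_le_one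
    _ = _ := one_mul _

end Family

/-! ## §7 (v1.1) The weighted energy bound and the covariant-derivative member in kernel form (row C2.Claim@263, non-flat `u`) -/

/-- kernel, the form at the weighted field versus the pairing: for `φ = G_k(Ω,u)f`, every positive weight `ω` with bond/block oscillation
`S₁`/`S₂` as in `agmon_weighted_region`, with `A = Σ(ω|φ|)²`, `B = Σ(ω|f|)²`:
`Σ_{b∈Ω*}‖(D_u(ωφ))(b)‖² + aΣ_{B^k(y)⊆Ω}‖(Q_k(u)(ωφ))(y)‖² ≤ √A·√B + (dc²S₁ + aS₂/(2N))·A` (the equation tested against `ω²φ`, Cauchy–Schwarz, the two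
conjugation defects). [cite: BalabanImbrieJaffe1985, (7.3.2) p.326] -/
theorem form_weighted_le {k : ℕ} (hk : j + k ≤ P.m + P.K) {Ω : Finset (Balaban1983to89.Site P j)} (hΩ : IsBlockUnion k Ω)
    (U : GaugeField P j U1) {c : ℝ} (hc : c ≠ 0) {a : ℝ} (ha : 0 < a)
    {ω : Balaban1983to89.Site P j → ℝ} (hωpos : ∀ x, 0 < ω x) {S₁ S₂ : ℝ} (hS₁ : 0 ≤ S₁) (hS₂ : 0 ≤ S₂)
    (hω₁ : ∀ b ∈ starB Ω, (ω b.tgt - ω b.src) ^ 2 ≤ S₁ * (ω b.tgt * ω b.src))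
    (hω₂ : ∀ x x' : Balaban1983to89.Site P j, blkIter k x = blkIter k x' → (ω x - ω x') ^ 2 ≤ S₂ * (ω x * ω x'))
    (f : Balaban1983to89.Site P j → ℂ) :
    ∑ b ∈ starB Ω, ‖covD c (cfg U) (fun x => (ω x : ℂ) * (gBox a c U k Ω *ᵥ f) x) b‖ ^ 2 +
        a * ∑ y ∈ innerK k Ω, ‖qCovK U k (fun x => (ω x : ℂ) * (gBox a c U k Ω *ᵥ f) x) y‖ ^ 2 ≤
      Real.sqrt (∑ x, (ω x * ‖(gBox a c U k Ω *ᵥ f) x‖) ^ 2) * Real.sqrt (∑ x, (ω x * ‖f x‖) ^ 2) +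
        (P.d * c ^ 2 * S₁ + a * (S₂ / (2 * (P.L : ℝ) ^ (k * P.d)))) * ∑ x, (ω x * ‖(gBox a c U k Ω *ᵥ f) x‖) ^ 2 := by
  classical
  set φ : Balaban1983to89.Site P j → ℂ := gBox a c U k Ω *ᵥ f with hφ
  set A : ℝ := ∑ x, (ω x * ‖φ x‖) ^ 2 with hA
  set B : ℝ := ∑ x, (ω x * ‖f x‖) ^ 2 with hB
  have hA0 : 0 ≤ A := sum_nonneg fun _ _ => sq_nonneg _
  have hB0 : 0 ≤ B := sum_nonneg fun _ _ => sq_nonneg _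
  -- the pairing `Re ψᴴ(nOp φ) ≤ √A√B`, `ψ = ω²φ`
  have h2 : (star (fun x => (ω x : ℂ) ^ 2 * φ x) ⬝ᵥ (nOp a c U k Ω *ᵥ φ)).re ≤ Real.sqrt A * Real.sqrt B := by
    rw [hφ, nOp_mulVec_gBox_mulVec hk hc ha U hΩ]
    have e : (star (fun x => (ω x : ℂ) ^ 2 * (gBox a c U k Ω *ᵥ f) x) ⬝ᵥ (proj Ω *ᵥ f)).re =
        ∑ x, ((conj ((ω x : ℂ) ^ 2 * (gBox a c U k Ω *ᵥ f) x)) * (if x ∈ Ω then f x else 0)).re := by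
      simp only [dotProduct, Pi.star_apply, proj_mulVec, Complex.re_sum, Complex.star_def]
    rw [e, ← hφ]
    have hpt : ∀ x, ((conj ((ω x : ℂ) ^ 2 * φ x)) * (if x ∈ Ω then f x else 0)).re ≤ (ω x * ‖φ x‖) * (ω x * ‖f x‖) := by
      intro x
      refine (Complex.re_le_norm _).trans ?_
      rw [norm_mul, RCLike.norm_conj, norm_mul, norm_pow, Complex.norm_real, Real.norm_of_nonneg (hωpos x).le]
      split_ifs
      · nlinarith [norm_nonneg (φ x), norm_nonneg (f x), (hωpos x).le]
      · rw [norm_zero, mul_zero]; exact mul_nonneg (mul_nonneg (hωpos x).le (norm_nonneg _)) (mul_nonneg (hωpos x).le (norm_nonneg _))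
    refine (sum_le_sum fun x _ => hpt x).trans ?_
    have hcs := sum_mul_sq_le_sq_mul_sq univ (fun x => ω x * ‖φ x‖) (fun x => ω x * ‖f x‖)
    rw [← Real.sqrt_mul hA0]
    refine Real.le_sqrt_of_sq_le ?_
    rw [hA, hB]
    exact hcs
  rw [form_nOp_eq] at h2
  have h3a := defectD_region_le c U Ω hS₁ hω₁ φ
  have h3b := defectQ_region_le hk U Ω hS₂ hω₂ φ
  rw [← hA] at h3a h3b
  have hre : (∑ b ∈ starB Ω, conj (covD c (cfg U) (fun x => (ω x : ℂ) ^ 2 * φ x) b) * covD c (cfg U) φ b +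
        (a : ℂ) * ∑ y ∈ innerK k Ω, conj (qCovK U k (fun x => (ω x : ℂ) ^ 2 * φ x) y) * qCovK U k φ y).re =
      (∑ b ∈ starB Ω, conj (covD c (cfg U) (fun x => (ω x : ℂ) ^ 2 * φ x) b) * covD c (cfg U) φ b).re +
        a * (∑ y ∈ innerK k Ω, conj (qCovK U k (fun x => (ω x : ℂ) ^ 2 * φ x) y) * qCovK U k φ y).re := by
    rw [Complex.add_re, Complex.re_ofReal_mul]
  rw [hre] at h2
  have h3b' := mul_le_mul_of_nonneg_left h3b ha.le
  nlinarith [h2, h3a, h3b']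

/-- **THE WEIGHTED ENERGY BOUND** (same data as `agmon_weighted_region`): the Neumann form at the weighted field `ωG_k(Ω,u)f` is bounded by
the weighted source, `Σ_{b∈Ω*}‖(D_u(ωφ))(b)‖² + aΣ_{B^k(y)⊆Ω}‖(Q_k(u)(ωφ))(y)‖² ≤ m₁·Σ(ω|f|)²/(m₁ − κ)²` (`m₁ = min(c²/(4n²), a/(4N))`,
`κ = dc²S₁ + aS₂/(2N)`). [cite: BalabanImbrieJaffe1985, (7.3.2) p.326] -/
theorem energy_weighted_region {k : ℕ} (hk : j + k ≤ P.m + P.K) {Ω : Finset (Balaban1983to89.Site P j)} (hΩ : IsBlockUnion k Ω)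
    (U : GaugeField P j U1) {T δ : ℝ}
    (hInt : ∀ b ∈ starB Ω, blkIter k b.src = blkIter k b.tgt → ‖toC (U b) - 1‖ ≤ T)
    (hTree : ∀ x ∈ Ω, ‖holCK U k x - 1‖ ≤ δ)
    (hsmall : 2 * (((P.L : ℝ) ^ k - 1) * (P.L : ℝ) ^ k) * P.d * T ^ 2 + 2 * δ ^ 2 ≤ 1 / 2)
    {c : ℝ} (hc : c ≠ 0) {a : ℝ} (ha : 0 < a)
    {ω : Balaban1983to89.Site P j → ℝ} (hωpos : ∀ x, 0 < ω x) {S₁ S₂ : ℝ} (hS₁ : 0 ≤ S₁) (hS₂ : 0 ≤ S₂)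
    (hω₁ : ∀ b ∈ starB Ω, (ω b.tgt - ω b.src) ^ 2 ≤ S₁ * (ω b.tgt * ω b.src))
    (hω₂ : ∀ x x' : Balaban1983to89.Site P j, blkIter k x = blkIter k x' → (ω x - ω x') ^ 2 ≤ S₂ * (ω x * ω x'))
    (hκ : P.d * c ^ 2 * S₁ + a * (S₂ / (2 * (P.L : ℝ) ^ (k * P.d)))
      < min (c ^ 2 / (4 * ((P.L : ℝ) ^ k) ^ 2)) (a / (4 * (P.L : ℝ) ^ (k * P.d))))
    (f : Balaban1983to89.Site P j → ℂ) :
    ∑ b ∈ starB Ω, ‖covD c (cfg U) (fun x => (ω x : ℂ) * (gBox a c U k Ω *ᵥ f) x) b‖ ^ 2 +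
        a * ∑ y ∈ innerK k Ω, ‖qCovK U k (fun x => (ω x : ℂ) * (gBox a c U k Ω *ᵥ f) x) y‖ ^ 2 ≤
      min (c ^ 2 / (4 * ((P.L : ℝ) ^ k) ^ 2)) (a / (4 * (P.L : ℝ) ^ (k * P.d))) * (∑ x, (ω x * ‖f x‖) ^ 2) /
        (min (c ^ 2 / (4 * ((P.L : ℝ) ^ k) ^ 2)) (a / (4 * (P.L : ℝ) ^ (k * P.d)))
          - (P.d * c ^ 2 * S₁ + a * (S₂ / (2 * (P.L : ℝ) ^ (k * P.d))))) ^ 2 := by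
  set m₁ : ℝ := min (c ^ 2 / (4 * ((P.L : ℝ) ^ k) ^ 2)) (a / (4 * (P.L : ℝ) ^ (k * P.d))) with hm₁
  set κ : ℝ := P.d * c ^ 2 * S₁ + a * (S₂ / (2 * (P.L : ℝ) ^ (k * P.d))) with hκdef
  set A : ℝ := ∑ x, (ω x * ‖(gBox a c U k Ω *ᵥ f) x‖) ^ 2 with hA
  set B : ℝ := ∑ x, (ω x * ‖f x‖) ^ 2 with hB
  have hA0 : 0 ≤ A := sum_nonneg fun _ _ => sq_nonneg _
  have hB0 : 0 ≤ B := sum_nonneg fun _ _ => sq_nonneg _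
  have hpos : 0 < m₁ - κ := sub_pos.2 hκ
  have hκ0 : 0 ≤ κ := by rw [hκdef]; positivity
  have hAg : A ≤ B / (m₁ - κ) ^ 2 := agmon_weighted_region hk hΩ U hInt hTree hsmall hc ha hωpos hS₁ hS₂ hω₁ hω₂ hκ f
  have hF := form_weighted_le hk hΩ U hc ha hωpos hS₁ hS₂ hω₁ hω₂ f
  rw [← hA, ← hB] at hF
  -- `√A ≤ √B/(m₁ − κ)`
  have hsA : Real.sqrt A ≤ Real.sqrt B / (m₁ - κ) := by
    have h := Real.sqrt_le_sqrt hAg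
    rwa [Real.sqrt_div' _ (sq_nonneg _), Real.sqrt_sq hpos.le] at h
  have h1 : Real.sqrt A * Real.sqrt B ≤ B / (m₁ - κ) := by
    calc Real.sqrt A * Real.sqrt B ≤ Real.sqrt B / (m₁ - κ) * Real.sqrt B := mul_le_mul_of_nonneg_right hsA (Real.sqrt_nonneg _)
      _ = B / (m₁ - κ) := by rw [div_mul_eq_mul_div, Real.mul_self_sqrt hB0]
  have h2 : κ * A ≤ κ * (B / (m₁ - κ) ^ 2) := mul_le_mul_of_nonneg_left hAg hκ0
  have e : B / (m₁ - κ) + κ * (B / (m₁ - κ) ^ 2) = m₁ * B / (m₁ - κ) ^ 2 := by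
    field_simp
    ring
  calc _ ≤ Real.sqrt A * Real.sqrt B + κ * A := hF
    _ ≤ B / (m₁ - κ) + κ * (B / (m₁ - κ) ^ 2) := add_le_add h1 h2
    _ = m₁ * B / (m₁ - κ) ^ 2 := e

/-- kernel: the weight moved through the covariant derivative — `ω(b₊)·(D_uφ)(b) = (D_u(ωφ))(b) − c(ω(b₊) − ω(b₋))φ(b₋)`, hence
`(ω(b₊)|(D_uφ)(b)|)² ≤ 2|(D_u(ωφ))(b)|² + 2c²(ω(b₊) − ω(b₋))²|φ(b₋)|²`. [cite: BalabanImbrieJaffe1988, (3.3) p.265] -/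
theorem weight_covD_sq_le (c : ℝ) (u : PBond P j → ℂ) (φ : Balaban1983to89.Site P j → ℂ) (ω : Balaban1983to89.Site P j → ℝ)
    (b : PBond P j) (hω : 0 ≤ ω b.tgt) :
    (ω b.tgt * ‖covD c u φ b‖) ^ 2 ≤
      2 * ‖covD c u (fun x => (ω x : ℂ) * φ x) b‖ ^ 2 + 2 * (c ^ 2 * ((ω b.tgt - ω b.src) ^ 2 * ‖φ b.src‖ ^ 2)) := by
  set X : ℂ := covD c u (fun x => (ω x : ℂ) * φ x) b with hX
  set Y : ℂ := (c : ℂ) * (((ω b.tgt - ω b.src : ℝ) : ℂ) * φ b.src) with hY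
  have e : ((ω b.tgt : ℂ)) * covD c u φ b = X - Y := by
    simp only [hX, hY, covD]; push_cast; ring
  have hn1 : ω b.tgt * ‖covD c u φ b‖ = ‖((ω b.tgt : ℂ)) * covD c u φ b‖ := by
    rw [norm_mul, Complex.norm_real, Real.norm_of_nonneg hω]
  have hY2 : ‖Y‖ ^ 2 = c ^ 2 * ((ω b.tgt - ω b.src) ^ 2 * ‖φ b.src‖ ^ 2) := by
    rw [hY, norm_mul, norm_mul, Complex.norm_real, Complex.norm_real, Real.norm_eq_abs, Real.norm_eq_abs, mul_pow, mul_pow, sq_abs,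
      sq_abs]
  rw [hn1, e, ← hY2]
  have h1 : ‖X - Y‖ ≤ ‖X‖ + ‖Y‖ := norm_sub_le X Y
  have h2 : ‖X - Y‖ ^ 2 ≤ (‖X‖ + ‖Y‖) ^ 2 := pow_le_pow_left₀ (norm_nonneg _) h1 2
  nlinarith [h2, sq_nonneg (‖X‖ - ‖Y‖)]

/-- kernel: the one-step growth of the weight `e^{t|x₀−·|_∞/L^k}` along a bond, `ω(b₊) ≤ e^{t/L^k}ω(b₋)` (`t ≥ 0`,
`||x₀−b₊|_∞ − |x₀−b₋|_∞| ≤ 1`). [folklore] -/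
private theorem weight_tgt_le_exp_mul_src {t : ℝ} (ht : 0 ≤ t) (k : ℕ) (x₀ : Balaban1983to89.Site P j) (b : PBond P j) :
    Real.exp (t * (supDist x₀ b.tgt : ℝ) / (P.L : ℝ) ^ k) ≤
      Real.exp (t / (P.L : ℝ) ^ k) * Real.exp (t * (supDist x₀ b.src : ℝ) / (P.L : ℝ) ^ k) := by
  rw [← Real.exp_add, Real.exp_le_exp]
  have hn : (0 : ℝ) ≤ t / (P.L : ℝ) ^ k := div_nonneg ht (pow_nonneg P.cast_L_pos.le k)
  have h1 := le_of_abs_le (abs_supDist_tgt_sub_src_le x₀ b)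
  have h3 : t / (P.L : ℝ) ^ k * ((supDist x₀ b.tgt : ℝ) - supDist x₀ b.src) ≤ t / (P.L : ℝ) ^ k * 1 :=
    mul_le_mul_of_nonneg_left h1 hn
  have h2 : t * (supDist x₀ b.tgt : ℝ) / (P.L : ℝ) ^ k =
      t / (P.L : ℝ) ^ k * ((supDist x₀ b.tgt : ℝ) - supDist x₀ b.src) + t * (supDist x₀ b.src : ℝ) / (P.L : ℝ) ^ k := by
    ring
  rw [h2]
  linarith

/-- kernel (real arithmetic of the derivative member): the two pieces `E₁ ≤ sp²/μ²` and `c²W ≤ (e²/sp²)(2sp²/μ)²` give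
`2E₁ + 2c²W ≤ (2 + 8e²)sp²/μ²`. [folklore] -/
private theorem deriv_pieces_arith {E₁ W c sp μ : ℝ} (hsp : 0 < sp) (hμ : 0 < μ) (h1 : E₁ ≤ sp ^ 2 / μ ^ 2)
    (h2 : c ^ 2 * W ≤ Real.exp 2 / sp ^ 2 * (2 * sp ^ 2 / μ) ^ 2) :
    2 * E₁ + 2 * (c ^ 2 * W) ≤ (2 + 8 * Real.exp 2) * sp ^ 2 / μ ^ 2 := by
  have e : Real.exp 2 / sp ^ 2 * (2 * sp ^ 2 / μ) ^ 2 = 4 * Real.exp 2 * sp ^ 2 / μ ^ 2 := by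
    field_simp; ring
  rw [e] at h2
  have e2 : (2 + 8 * Real.exp 2) * sp ^ 2 / μ ^ 2 = 2 * (sp ^ 2 / μ ^ 2) + 2 * (4 * Real.exp 2 * sp ^ 2 / μ ^ 2) := by ring
  rw [e2]
  linarith

/-- kernel (real arithmetic of the oscillation piece): from the bond oscillation `(ω₊ − ω₋)² ≤ τE·ω₊ω₋`, the step `ω₊ ≤ Eω₋`,
`(ω₋|φ₋|)² ≤ A`, `c²τ ≤ 1/sp²` and `E² ≤ e²`: `c²(ω₊ − ω₋)²|φ₋|² ≤ (e²/sp²)·A`. [folklore] -/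
private theorem osc_piece_arith {ωt ωs φs c τ E A sp : ℝ}
    (hO : (ωt - ωs) ^ 2 ≤ τ * E * (ωt * ωs)) (hw : ωt ≤ E * ωs) (hsrc : (ωs * φs) ^ 2 ≤ A)
    (hωs : 0 ≤ ωs) (hτ : 0 ≤ τ) (hE : 0 ≤ E)
    (ht2 : c ^ 2 * τ ≤ 1 / sp ^ 2) (he2 : E * E ≤ Real.exp 2) :
    c ^ 2 * ((ωt - ωs) ^ 2 * φs ^ 2) ≤ Real.exp 2 / sp ^ 2 * A := by
  have hw' : ωt * ωs ≤ E * ωs ^ 2 :=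
    calc ωt * ωs ≤ (E * ωs) * ωs := mul_le_mul_of_nonneg_right hw hωs
      _ = E * ωs ^ 2 := by ring
  have h1 : (ωt - ωs) ^ 2 ≤ τ * E * (E * ωs ^ 2) := hO.trans (mul_le_mul_of_nonneg_left hw' (mul_nonneg hτ hE))
  have h2 : (ωt - ωs) ^ 2 * φs ^ 2 ≤ τ * (E * E) * (ωs * φs) ^ 2 :=
    calc (ωt - ωs) ^ 2 * φs ^ 2 ≤ τ * E * (E * ωs ^ 2) * φs ^ 2 := mul_le_mul_of_nonneg_right h1 (sq_nonneg _)
      _ = τ * (E * E) * (ωs * φs) ^ 2 := by ring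
  have hsp2 : 0 ≤ 1 / sp ^ 2 := by positivity
  calc c ^ 2 * ((ωt - ωs) ^ 2 * φs ^ 2) ≤ c ^ 2 * (τ * (E * E) * (ωs * φs) ^ 2) :=
        mul_le_mul_of_nonneg_left h2 (sq_nonneg _)
    _ = (c ^ 2 * τ) * (E * E) * (ωs * φs) ^ 2 := by ring
    _ ≤ (1 / sp ^ 2) * Real.exp 2 * A :=
        mul_le_mul (mul_le_mul ht2 he2 (mul_nonneg hE hE) hsp2) hsrc (sq_nonneg _) (mul_nonneg hsp2 (Real.exp_pos _).le)
    _ = Real.exp 2 / sp ^ 2 * A := by ring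

/-- kernel (real arithmetic, the assembly of the derivative member): from the gap `μ/(2sp²) ≤ m₁ − κ`, `m₁ ≤ 1/(4sp²)`, the region
Agmon bound `A ≤ 1/(m₁ − κ)²` and the weighted energy bound `E₁ + Q ≤ m₁/(m₁ − κ)²` at the source `δ_y`, the single terms `e_b ≤ E₁`,
`(ω₋|φ₋|)² ≤ A`, the splitting `(ω₊|D_uφ(b)|)² ≤ 2e_b + 2c²(ω₊ − ω₋)²|φ₋|²` and the data of `osc_piece_arith`:
`ω₊|D_uφ(b)| ≤ (√(2 + 8e²)/μ)·sp`. [folklore] -/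
private theorem covD_member_arith {sp μ m₁ κ A E₁ Q eb ωt ωs φs nb c τ E : ℝ} (hsp : 0 < sp) (hμ : 0 < μ)
    (hge : μ / (2 * sp ^ 2) ≤ m₁ - κ) (hm₁le : m₁ ≤ 1 / (4 * sp ^ 2))
    (hAg : A ≤ 1 / (m₁ - κ) ^ 2) (hEn : E₁ + Q ≤ m₁ * 1 / (m₁ - κ) ^ 2) (hQ : 0 ≤ Q)
    (heb : eb ≤ E₁) (hsrc : (ωs * φs) ^ 2 ≤ A)
    (hsplit : (ωt * nb) ^ 2 ≤ 2 * eb + 2 * (c ^ 2 * ((ωt - ωs) ^ 2 * φs ^ 2))) (h0 : 0 ≤ ωt * nb)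
    (hO : (ωt - ωs) ^ 2 ≤ τ * E * (ωt * ωs)) (hw : ωt ≤ E * ωs) (hωs : 0 ≤ ωs) (hτ : 0 ≤ τ) (hE : 0 ≤ E)
    (ht2 : c ^ 2 * τ ≤ 1 / sp ^ 2) (he2 : E * E ≤ Real.exp 2) :
    ωt * nb ≤ Real.sqrt (2 + 8 * Real.exp 2) / μ * sp := by
  have hDpos : 0 < m₁ - κ := lt_of_lt_of_le (by positivity) hge
  have hinv : 1 / (m₁ - κ) ≤ 2 * sp ^ 2 / μ := by
    rw [div_le_div_iff₀ hDpos hμ, one_mul]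
    have := (div_le_iff₀ (by positivity : (0 : ℝ) < 2 * sp ^ 2)).1 hge
    linarith
  have hinv0 : 0 ≤ 1 / (m₁ - κ) := div_nonneg zero_le_one hDpos.le
  have hE₁ : E₁ ≤ sp ^ 2 / μ ^ 2 := by
    have h1 : m₁ * 1 / (m₁ - κ) ^ 2 ≤ (1 / (4 * sp ^ 2)) * (2 * sp ^ 2 / μ) ^ 2 := by
      rw [mul_one, show m₁ / (m₁ - κ) ^ 2 = m₁ * (1 / (m₁ - κ)) ^ 2 by field_simp]
      exact mul_le_mul hm₁le (pow_le_pow_left₀ hinv0 hinv 2) (sq_nonneg _) (by positivity)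
    have h2 : (1 / (4 * sp ^ 2)) * (2 * sp ^ 2 / μ) ^ 2 = sp ^ 2 / μ ^ 2 := by
      field_simp; ring
    linarith
  have hAle : A ≤ (2 * sp ^ 2 / μ) ^ 2 := by
    refine hAg.trans ?_
    rw [show (1 : ℝ) / (m₁ - κ) ^ 2 = (1 / (m₁ - κ)) ^ 2 by rw [div_pow, one_pow]]
    exact pow_le_pow_left₀ hinv0 hinv 2
  have hpiece2 := osc_piece_arith hO hw (hsrc.trans hAle) hωs hτ hE ht2 he2
  have htot : (ωt * nb) ^ 2 ≤ (2 + 8 * Real.exp 2) * sp ^ 2 / μ ^ 2 :=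
    hsplit.trans (deriv_pieces_arith hsp hμ (heb.trans hE₁) hpiece2)
  have e : (Real.sqrt (2 + 8 * Real.exp 2) / μ * sp) ^ 2 = (2 + 8 * Real.exp 2) * sp ^ 2 / μ ^ 2 := by
    rw [mul_pow, div_pow, Real.sq_sqrt (by positivity)]; ring
  exact (pow_le_pow_iff_left₀ h0 (by positivity) two_ne_zero).1 (htot.trans_eq e.symm)

/-- kernel: dividing out the weight, `e^s·x ≤ C ⟹ x ≤ C·e^{−s}`. [folklore] -/
private theorem le_mul_exp_neg_of {s x C : ℝ} (h : Real.exp s * x ≤ C) : x ≤ C * Real.exp (-s) := by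
  rw [Real.exp_neg, ← div_eq_mul_inv, le_div_iff₀ (Real.exp_pos s), mul_comm]
  exact h

/-- **THE COVARIANT-DERIVATIVE MEMBER IN KERNEL FORM AT NON-FLAT SMALL FIELDS** (p. 263: *"Bounds analogous to (2.30), (2.31) hold for
covariant derivatives … of G_{k,loc}(u)"*; [6] (1.10), the `|(D^η_{A,μ}G_k(Ω,A)f)(x)|` member, here for the source `δ_y`): there are
`t₀, c₁ > 0` depending on `(d, a)` only such that, at the data of `decay_kernel_smallField_region`, for every bond `b ∈ Ω*` and every `y`,
`‖ε⁻¹(u_bG_k(Ω,u;b₊,y) − G_k(Ω,u;b₋,y))‖ ≤ c₁(L^kε)e^{−t₀|y−b₊|_∞/L^k}` — from the weighted energy bound at the weight `e^{t₀|y−·|_∞/L^k}`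
(`(ω(b₊)|D_uφ(b)|)² ≤ 2|D_u(ωφ)(b)|² + 2c²(ω(b₊) − ω(b₋))²|φ(b₋)|²`). [cite: BalabanImbrieJaffe1988, (2.30) p.263] -/
theorem decay_covD_kernel_smallField_region (d : ℕ) {a : ℝ} (ha : 0 < a) :
    ∃ t₀ c₁ : ℝ, 0 < t₀ ∧ 0 < c₁ ∧ ∀ (P : Params), P.d = d →
      ∀ k : ℕ, 1 ≤ k → k ≤ P.m + P.K → ∀ (Ω : Finset (Balaban1983to89.Site P 0)), IsBlockUnion k Ω →
        ∀ (U : GaugeField P 0 U1) (T δ : ℝ),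
          (∀ b ∈ starB Ω, blkIter k b.src = blkIter k b.tgt → ‖toC (U b) - 1‖ ≤ T) →
          (∀ x ∈ Ω, ‖holCK U k x - 1‖ ≤ δ) →
          2 * (((P.L : ℝ) ^ k - 1) * (P.L : ℝ) ^ k) * P.d * T ^ 2 + 2 * δ ^ 2 ≤ 1 / 2 →
          ∀ b ∈ starB Ω, ∀ y : Balaban1983to89.Site P 0,
            ‖covD P.eps⁻¹ (cfg U) (fun x => gBox (B1RG242Torus.α P a k * (P.L : ℝ) ^ (k * P.d)) P.eps⁻¹ U k Ω x y) b‖ ≤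
              c₁ * P.spacing k * Real.exp (-(t₀ * (supDist y b.tgt : ℝ) / (P.L : ℝ) ^ k)) := by
  obtain ⟨μ₁, hμ₁⟩ : ∃ μ : ℝ, μ = min (1 / 4) (a / 8) := ⟨_, rfl⟩
  have hμ₁pos : 0 < μ₁ := by rw [hμ₁]; exact lt_min (by norm_num) (by positivity)
  obtain ⟨t, htdef⟩ : ∃ t : ℝ, t = min 1 (μ₁ / ((2 * d + a) * Real.exp 1)) := ⟨_, rfl⟩
  have htpos : 0 < t := by rw [htdef]; exact lt_min one_pos (by positivity)
  have ht1 : t ≤ 1 := by rw [htdef]; exact min_le_left _ _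
  have htμ : t ≤ μ₁ / ((2 * d + a) * Real.exp 1) := by rw [htdef]; exact min_le_right _ _
  refine ⟨t, Real.sqrt (2 + 8 * Real.exp 2) / μ₁, htpos, by positivity, ?_⟩
  intro P hPd k hk1 hk Ω hΩ U T δ hInt hTree hsmall b hb y
  subst hPd
  have hk0 : 0 + k ≤ P.m + P.K := by omega
  have hLpos : (0 : ℝ) < P.L := P.cast_L_pos
  have hL1 : (1 : ℝ) < P.L := B1RG242Torus.one_lt_cast_L P
  have hn1 : 1 ≤ (P.L : ℝ) ^ k := one_le_pow₀ hL1.le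
  have hN : 0 < (P.L : ℝ) ^ (k * P.d) := pow_pos hLpos _
  have hsp : 0 < P.spacing k := P.spacing_pos k
  have hspdef : P.spacing k = (P.L : ℝ) ^ k * P.eps := rfl
  have hα : 0 < B1RG242Torus.α P a k := mul_pos (B1.aSeq_pos ha hL1 hk1) (inv_pos.2 (pow_pos hsp 2))
  have ha' : 0 < B1RG242Torus.α P a k * (P.L : ℝ) ^ (k * P.d) := mul_pos hα hN
  have hc : P.eps⁻¹ ≠ 0 := inv_ne_zero P.eps_pos.ne'
  -- the weight centred at the source point `y`, its oscillations and its one-step growth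
  obtain ⟨ω, hω⟩ : ∃ ω : Balaban1983to89.Site P 0 → ℝ, ω = fun z => Real.exp (t * (supDist y z : ℝ) / (P.L : ℝ) ^ k) :=
    ⟨_, rfl⟩
  have hωpos : ∀ z, 0 < ω z := fun z => by rw [hω]; exact Real.exp_pos _
  have hst : |t| ≤ t := (abs_of_pos htpos).le
  have hω₁ : ∀ b ∈ starB Ω, (ω b.tgt - ω b.src) ^ 2 ≤
      ((t / (P.L : ℝ) ^ k) ^ 2 * Real.exp (t / (P.L : ℝ) ^ k)) * (ω b.tgt * ω b.src) := fun b _ => by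
    rw [hω]; exact weight_bond_osc_sq hst k y b
  have hω₂ : ∀ z z' : Balaban1983to89.Site P 0, blkIter k z = blkIter k z' →
      (ω z - ω z') ^ 2 ≤ (t ^ 2 * Real.exp t) * (ω z * ω z') := fun z z' hzz => by
    rw [hω]; exact weight_block_osc_sq hst hk0 y z z' hzz
  have hωts : ω b.tgt ≤ Real.exp (t / (P.L : ℝ) ^ k) * ω b.src := by
    rw [hω]; exact weight_tgt_le_exp_mul_src htpos.le k y b
  have hωt : ω b.tgt = Real.exp (t * (supDist y b.tgt : ℝ) / (P.L : ℝ) ^ k) := by rw [hω]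
  -- the gap, and the §3/§7 bounds at the source `δ_y` (`B = 1`)
  have hge := agmon_gap_region P ha hk1 htpos.le ht1 (by rw [← hμ₁]; exact htμ)
  rw [← hμ₁] at hge
  have hν : 0 < μ₁ / (2 * P.spacing k ^ 2) := by positivity
  have hκ := sub_pos.1 (lt_of_lt_of_le hν hge)
  have hB : ∑ z, (ω z * ‖(Pi.single y (1 : ℂ) : Balaban1983to89.Site P 0 → ℂ) z‖) ^ 2 = 1 := by
    rw [Finset.sum_eq_single y]
    · simp [hω, B3TorusRadialSums.supDist_eq_zero_iff]
    · intro z _ hz; simp [hz]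
    · exact fun h => absurd (mem_univ _) h
  have hAg := agmon_weighted_region hk0 hΩ U hInt hTree hsmall hc ha' hωpos (by positivity) (by positivity) hω₁ hω₂ hκ
    (Pi.single y 1)
  have hEn := energy_weighted_region hk0 hΩ U hInt hTree hsmall hc ha' hωpos (by positivity) (by positivity) hω₁ hω₂ hκ
    (Pi.single y 1)
  rw [hB] at hAg hEn
  -- the column `y` of `G_k(Ω,u)` is the field of the source `δ_y`
  obtain ⟨φ, hφ⟩ : ∃ φ : Balaban1983to89.Site P 0 → ℂ,
      φ = gBox (B1RG242Torus.α P a k * (P.L : ℝ) ^ (k * P.d)) P.eps⁻¹ U k Ω *ᵥ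
        (Pi.single y (1 : ℂ) : Balaban1983to89.Site P 0 → ℂ) := ⟨_, rfl⟩
  rw [← hφ] at hAg hEn
  have hφfun : (fun x => gBox (B1RG242Torus.α P a k * (P.L : ℝ) ^ (k * P.d)) P.eps⁻¹ U k Ω x y) = φ :=
    funext fun x => by rw [hφ, mulVec_single_one, col_apply]
  rw [hφfun]
  -- the scalar sizes
  have hm₁le : min ((P.eps⁻¹) ^ 2 / (4 * ((P.L : ℝ) ^ k) ^ 2))
      (B1RG242Torus.α P a k * (P.L : ℝ) ^ (k * P.d) / (4 * (P.L : ℝ) ^ (k * P.d))) ≤ 1 / (4 * P.spacing k ^ 2) := by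
    refine (min_le_left _ _).trans (le_of_eq ?_)
    rw [hspdef]; field_simp
  have he2 : Real.exp (t / (P.L : ℝ) ^ k) * Real.exp (t / (P.L : ℝ) ^ k) ≤ Real.exp 2 := by
    rw [← Real.exp_add, Real.exp_le_exp]
    have := (div_le_self htpos.le hn1).trans ht1
    linarith
  have ht2 : (P.eps⁻¹) ^ 2 * (t / (P.L : ℝ) ^ k) ^ 2 ≤ 1 / P.spacing k ^ 2 := by
    have e : (P.eps⁻¹) ^ 2 * (t / (P.L : ℝ) ^ k) ^ 2 = t ^ 2 * (1 / P.spacing k ^ 2) := by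
      rw [hspdef]; field_simp
    rw [e]
    exact mul_le_of_le_one_left (by positivity) (pow_le_one₀ htpos.le ht1)
  have h0Q : 0 ≤ B1RG242Torus.α P a k * (P.L : ℝ) ^ (k * P.d) *
      ∑ y' ∈ innerK k Ω, ‖qCovK U k (fun x => (ω x : ℂ) * φ x) y'‖ ^ 2 := by positivity
  have heb : ‖covD P.eps⁻¹ (cfg U) (fun x => (ω x : ℂ) * φ x) b‖ ^ 2 ≤
      ∑ b' ∈ starB Ω, ‖covD P.eps⁻¹ (cfg U) (fun x => (ω x : ℂ) * φ x) b'‖ ^ 2 :=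
    Finset.single_le_sum (f := fun b' => ‖covD P.eps⁻¹ (cfg U) (fun x => (ω x : ℂ) * φ x) b'‖ ^ 2)
      (fun _ _ => sq_nonneg _) hb
  have hsrc : (ω b.src * ‖φ b.src‖) ^ 2 ≤ ∑ z, (ω z * ‖φ z‖) ^ 2 :=
    Finset.single_le_sum (f := fun z => (ω z * ‖φ z‖) ^ 2) (fun _ _ => sq_nonneg _) (mem_univ b.src)
  have hsplit := weight_covD_sq_le P.eps⁻¹ (cfg U) φ ω b (hωpos b.tgt).le
  -- assembly (pure real arithmetic) and division by the weight
  have hmain : ω b.tgt * ‖covD P.eps⁻¹ (cfg U) φ b‖ ≤ Real.sqrt (2 + 8 * Real.exp 2) / μ₁ * P.spacing k :=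
    covD_member_arith hsp hμ₁pos hge hm₁le hAg hEn h0Q heb hsrc hsplit (mul_nonneg (hωpos _).le (norm_nonneg _))
      (hω₁ b hb) hωts (hωpos b.src).le (sq_nonneg _) (Real.exp_pos _).le ht2 he2
  rw [hωt] at hmain
  exact le_mul_exp_neg_of hmain


/-! ## §8 (v1.2) The covariant-derivative member for (2.27) `G̃_k(u)` and (2.28) `G_{k,loc}(u)` at non-flat small fields -/

/-- kernel: the covariant derivative is additive over a finite family of fields. [cite: BalabanImbrieJaffe1988, (3.3) p.265] -/
theorem covD_sum {ι : Type*} (s : Finset ι) (c : ℝ) (u : PBond P j → ℂ) (φ : ι → Balaban1983to89.Site P j → ℂ)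
    (b : PBond P j) : covD c u (fun x => ∑ i ∈ s, φ i x) b = ∑ i ∈ s, covD c u (φ i) b := by
  simp only [covD]
  rw [Finset.mul_sum, ← Finset.sum_sub_distrib, Finset.mul_sum]

/-- kernel: the covariant derivative of a field multiplied by a real weight in the output point — the weight moved through `D_u`:
`(D_u(λφ))(b) = λ(b₊)(D_uφ)(b) + c(λ(b₊) − λ(b₋))φ(b₋)`. [cite: BalabanImbrieJaffe1988, (3.3) p.265] -/
theorem covD_weight_mul (c : ℝ) (u : PBond P j → ℂ) (lam : Balaban1983to89.Site P j → ℝ) (φ : Balaban1983to89.Site P j → ℂ)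
    (b : PBond P j) :
    covD c u (fun x => (lam x : ℂ) * φ x) b =
      (lam b.tgt : ℂ) * covD c u φ b + (c : ℂ) * ((lam b.tgt - lam b.src : ℝ) : ℂ) * φ b.src := by
  simp only [covD]
  push_cast
  ring

/-- kernel: the norm of the weighted covariant derivative from a bound `A` on `‖(D_uφ)(b)‖` and a bound `B` on `‖φ(b₋)‖`:
`‖(D_u(λφ))(b)‖ ≤ |λ(b₊)|A + |c||λ(b₊) − λ(b₋)|B`. [cite: BalabanImbrieJaffe1988, (3.3) p.265] -/
theorem norm_covD_weight_mul_le {c : ℝ} {u : PBond P j → ℂ} {lam : Balaban1983to89.Site P j → ℝ}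
    {φ : Balaban1983to89.Site P j → ℂ} {b : PBond P j} {A B : ℝ} (hA : ‖covD c u φ b‖ ≤ A) (hB : ‖φ b.src‖ ≤ B) :
    ‖covD c u (fun x => (lam x : ℂ) * φ x) b‖ ≤ |lam b.tgt| * A + |c| * |lam b.tgt - lam b.src| * B := by
  rw [covD_weight_mul]
  calc ‖(lam b.tgt : ℂ) * covD c u φ b + (c : ℂ) * ((lam b.tgt - lam b.src : ℝ) : ℂ) * φ b.src‖
      ≤ ‖(lam b.tgt : ℂ) * covD c u φ b‖ + ‖(c : ℂ) * ((lam b.tgt - lam b.src : ℝ) : ℂ) * φ b.src‖ := norm_add_le _ _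
    _ = |lam b.tgt| * ‖covD c u φ b‖ + |c| * |lam b.tgt - lam b.src| * ‖φ b.src‖ := by
        rw [norm_mul, norm_mul, norm_mul, Complex.norm_real, Complex.norm_real, Complex.norm_real, Real.norm_eq_abs,
          Real.norm_eq_abs, Real.norm_eq_abs]
    _ ≤ |lam b.tgt| * A + |c| * |lam b.tgt - lam b.src| * B :=
        add_le_add (mul_le_mul_of_nonneg_left hA (abs_nonneg _)) (mul_le_mul_of_nonneg_left hB (by positivity))

/-- kernel: the same when the derivative bound `A` is only available under a condition `p` (the bond lies in `□*`) outside of which the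
weight vanishes at both ends of the bond (then `(D_u(λφ))(b) = 0`). [cite: BalabanImbrieJaffe1988, (2.27) p.263] -/
private theorem norm_covD_weight_mul_le_of {p : Prop} {c : ℝ} {u : PBond P j → ℂ} {lam : Balaban1983to89.Site P j → ℝ}
    {φ : Balaban1983to89.Site P j → ℂ} {b : PBond P j} {A B : ℝ} (hA : p → ‖covD c u φ b‖ ≤ A) (hA0 : 0 ≤ A)
    (hp : ¬p → lam b.tgt = 0 ∧ lam b.src = 0) (hB : ‖φ b.src‖ ≤ B) :
    ‖covD c u (fun x => (lam x : ℂ) * φ x) b‖ ≤ |lam b.tgt| * A + |c| * |lam b.tgt - lam b.src| * B := by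
  by_cases h : p
  · exact norm_covD_weight_mul_le (hA h) hB
  · obtain ⟨h1, h2⟩ := hp h
    have h0 : covD c u (fun x => (lam x : ℂ) * φ x) b = 0 := by
      simp only [covD, h1, h2, Complex.ofReal_zero, zero_mul, mul_zero, sub_zero]
    have hB0 : 0 ≤ B := (norm_nonneg _).trans hB
    rw [h0, norm_zero]
    positivity

/-- kernel: one bond step of the decreasing weight costs at most a factor `e`: `e^{−t|x₀−b₋|_∞/n} ≤ e·e^{−t|x₀−b₊|_∞/n}` for
`0 ≤ t ≤ 1 ≤ n`. [folklore] -/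
private theorem exp_neg_src_le_exp_one_mul {t n : ℝ} (ht0 : 0 ≤ t) (ht1 : t ≤ 1) (hn : 1 ≤ n)
    (x₀ : Balaban1983to89.Site P j) (b : PBond P j) :
    Real.exp (-(t * (supDist x₀ b.src : ℝ) / n)) ≤ Real.exp 1 * Real.exp (-(t * (supDist x₀ b.tgt : ℝ) / n)) := by
  rw [← Real.exp_add, Real.exp_le_exp]
  have hn0 : 0 < n := by linarith
  have htn : t / n ≤ 1 := (div_le_one hn0).2 (ht1.trans hn)
  have htn0 : 0 ≤ t / n := div_nonneg ht0 hn0.le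
  have h1 := le_of_abs_le (abs_supDist_tgt_sub_src_le x₀ b)
  have h3 : t / n * ((supDist x₀ b.tgt : ℝ) - supDist x₀ b.src) ≤ t / n * 1 := mul_le_mul_of_nonneg_left h1 htn0
  have h2 : -(t * (supDist x₀ b.src : ℝ) / n) =
      t / n * ((supDist x₀ b.tgt : ℝ) - supDist x₀ b.src) + -(t * (supDist x₀ b.tgt : ℝ) / n) := by ring
  rw [h2]
  linarith

/-- kernel: a slower rate decays less, `e^{−t|x₀−z|_∞/n} ≤ e^{−t₀|x₀−z|_∞/n}` for `t₀ ≤ t`. [folklore] -/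
private theorem exp_neg_rate_mono {t₀ t n : ℝ} (ht : t₀ ≤ t) (hn : 0 ≤ n) (x₀ z : Balaban1983to89.Site P j) :
    Real.exp (-(t * (supDist x₀ z : ℝ) / n)) ≤ Real.exp (-(t₀ * (supDist x₀ z : ℝ) / n)) := by
  rw [Real.exp_le_exp, neg_le_neg_iff]
  exact div_le_div_of_nonneg_right (mul_le_mul_of_nonneg_right ht (Nat.cast_nonneg _)) hn

section FamilyDeriv

/-- **THE COVARIANT-DERIVATIVE MEMBER FOR (2.27) `G̃_k(u) = Σ_αλ_αG_k(□_α,u)` AT NON-FLAT SMALL FIELDS** (p. 263: *"Bounds analogous to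
(2.30), (2.31) hold for covariant derivatives … of G_{k,loc}(u)"*), in KERNEL form, over ANY finite family of regions `□_α` that are unions
of `k`-blocks and ANY real weights `λ_α(x₁,x₂)` with `Σ_α|λ_α(x₁,x₂)| ≤ 1` that are (i) supported, in the output point, in the bond
interior of their region (`λ_α(b₊,·) = λ_α(b₋,·) = 0` for every bond `b ∉ □_α*` — a support condition of the type of p29's row
hypothesis (ii) `BIJ88LocWeights227Torus.rowHyp_ii` for the torus data of record, displayed here, not discharged) and (ii) smooth in the
output point at the bond scale, `Σ_α|λ_α(b₊,y) − λ_α(b₋,y)| ≤ ℓ` (print: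
*"we interpolate in a smooth fashion"*): with the weight moved through `D_u` (`covD_weight_mul`), §7 for the bonds of `□_α*` and §4 for the
values, `‖(D_uG̃_k(u)(·,y))(b)‖ ≤ (c₁(L^kε) + c₂ℓε⁻¹(L^kε)²)e^{−t₀|y−b₊|_∞/L^k}` for EVERY bond `b` of the torus, `t₀, c₁, c₂ > 0` depending
on `(d, a)` only (for weights smooth on the scale of the cubes, `ℓ ~ (ML^k)⁻¹`, the second term is `~ c₂(L^kε)/M`).
[cite: BalabanImbrieJaffe1988, (2.27) p.263] -/
theorem decay_covD_gTilde_smallField_kernel (d : ℕ) {a : ℝ} (ha : 0 < a) :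
    ∃ t₀ c₁ c₂ : ℝ, 0 < t₀ ∧ 0 < c₁ ∧ 0 < c₂ ∧ ∀ (P : Params), P.d = d →
      ∀ k : ℕ, 1 ≤ k → k ≤ P.m + P.K → ∀ (ι : Type) [Fintype ι] (cube : ι → Finset (Balaban1983to89.Site P 0))
        (lam : ι → Balaban1983to89.Site P 0 → Balaban1983to89.Site P 0 → ℝ) (ℓ : ℝ),
        (∀ α, IsBlockUnion k (cube α)) → (∀ x y, ∑ α, |lam α x y| ≤ 1) →
        (∀ α (b : PBond P 0) y, b ∉ starB (cube α) → lam α b.tgt y = 0 ∧ lam α b.src y = 0) →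
        (∀ (b : PBond P 0) y, ∑ α, |lam α b.tgt y - lam α b.src y| ≤ ℓ) →
        ∀ (U : GaugeField P 0 U1) (T δ : ℝ),
          (∀ b : PBond P 0, blkIter k b.src = blkIter k b.tgt → ‖toC (U b) - 1‖ ≤ T) →
          (∀ x, ‖holCK U k x - 1‖ ≤ δ) →
          2 * (((P.L : ℝ) ^ k - 1) * (P.L : ℝ) ^ k) * P.d * T ^ 2 + 2 * δ ^ 2 ≤ 1 / 2 →
          ∀ (b : PBond P 0) (y : Balaban1983to89.Site P 0),
            ‖covD P.eps⁻¹ (cfg U)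
                (fun x => gTilde (B1RG242Torus.α P a k * (P.L : ℝ) ^ (k * P.d)) P.eps⁻¹ U k cube lam x y) b‖ ≤
              (c₁ * P.spacing k + c₂ * ℓ * P.eps⁻¹ * P.spacing k ^ 2) *
                Real.exp (-(t₀ * (supDist y b.tgt : ℝ) / (P.L : ℝ) ^ k)) := by
  obtain ⟨t₁, c₀, ht₁, hc₀, HV⟩ := decay_kernel_smallField_region d ha
  obtain ⟨t₂, c₁, ht₂, hc₁, HD⟩ := decay_covD_kernel_smallField_region d ha
  have ht₀pos : 0 < min 1 (min t₁ t₂) := lt_min one_pos (lt_min ht₁ ht₂)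
  refine ⟨min 1 (min t₁ t₂), c₁, Real.exp 1 * c₀, ht₀pos, hc₁, by positivity, ?_⟩
  intro P hPd k hk1 hk ι _ cube lam ℓ hcube hlam hsupp hlip U T δ hInt hTree hsmall b y
  obtain ⟨t₀, ht₀⟩ : ∃ t : ℝ, t = min 1 (min t₁ t₂) := ⟨_, rfl⟩
  rw [← ht₀] at ht₀pos ⊢
  have ht₀1 : t₀ ≤ 1 := ht₀ ▸ min_le_left _ _
  have ht₀t₁ : t₀ ≤ t₁ := ht₀ ▸ (min_le_right _ _).trans (min_le_left _ _)
  have ht₀t₂ : t₀ ≤ t₂ := ht₀ ▸ (min_le_right _ _).trans (min_le_right _ _)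
  have hn1 : (1 : ℝ) ≤ (P.L : ℝ) ^ k := one_le_pow₀ (B1RG242Torus.one_lt_cast_L P).le
  have hn0 : (0 : ℝ) ≤ (P.L : ℝ) ^ k := zero_le_one.trans hn1
  have hsp : 0 < P.spacing k := P.spacing_pos k
  -- the value and derivative bounds for each region at the common rate `t₀`
  have hVal : ∀ α z, ‖gBox (B1RG242Torus.α P a k * (P.L : ℝ) ^ (k * P.d)) P.eps⁻¹ U k (cube α) z y‖ ≤
      c₀ * P.spacing k ^ 2 * Real.exp (-(t₀ * (supDist y z : ℝ) / (P.L : ℝ) ^ k)) := fun α z => by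
    have h := HV P hPd k hk1 hk (cube α) (hcube α) U T δ (fun b _ hb => hInt b hb) (fun z _ => hTree z) hsmall z y
    rw [B3TorusRadialSums.supDist_comm z y] at h
    exact h.trans (mul_le_mul_of_nonneg_left (exp_neg_rate_mono ht₀t₁ hn0 y z) (by positivity))
  have hDer : ∀ α, b ∈ starB (cube α) →
      ‖covD P.eps⁻¹ (cfg U) (fun x => gBox (B1RG242Torus.α P a k * (P.L : ℝ) ^ (k * P.d)) P.eps⁻¹ U k (cube α) x y) b‖ ≤
        c₁ * P.spacing k * Real.exp (-(t₀ * (supDist y b.tgt : ℝ) / (P.L : ℝ) ^ k)) := fun α hb =>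
    (HD P hPd k hk1 hk (cube α) (hcube α) U T δ (fun b _ hb => hInt b hb) (fun z _ => hTree z) hsmall b hb y).trans
      (mul_le_mul_of_nonneg_left (exp_neg_rate_mono ht₀t₂ hn0 y b.tgt) (by positivity))
  have hEsrc : Real.exp (-(t₀ * (supDist y b.src : ℝ) / (P.L : ℝ) ^ k)) ≤
      Real.exp 1 * Real.exp (-(t₀ * (supDist y b.tgt : ℝ) / (P.L : ℝ) ^ k)) :=
    exp_neg_src_le_exp_one_mul ht₀pos.le ht₀1 hn1 y b
  -- the field of (2.27) as a finite sum; the derivative is additive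
  have hfun : (fun x => gTilde (B1RG242Torus.α P a k * (P.L : ℝ) ^ (k * P.d)) P.eps⁻¹ U k cube lam x y) =
      fun x => ∑ α, (fun α x => (lam α x y : ℂ) *
        gBox (B1RG242Torus.α P a k * (P.L : ℝ) ^ (k * P.d)) P.eps⁻¹ U k (cube α) x y) α x :=
    funext fun x => by rw [gTilde_apply]
  rw [hfun, covD_sum]
  -- one region at a time
  have hterm : ∀ α, ‖covD P.eps⁻¹ (cfg U) (fun x => (lam α x y : ℂ) *
      gBox (B1RG242Torus.α P a k * (P.L : ℝ) ^ (k * P.d)) P.eps⁻¹ U k (cube α) x y) b‖ ≤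
        |lam α b.tgt y| * (c₁ * P.spacing k * Real.exp (-(t₀ * (supDist y b.tgt : ℝ) / (P.L : ℝ) ^ k))) +
          |P.eps⁻¹| * |lam α b.tgt y - lam α b.src y| *
            (c₀ * P.spacing k ^ 2 * Real.exp (-(t₀ * (supDist y b.src : ℝ) / (P.L : ℝ) ^ k))) := fun α =>
    norm_covD_weight_mul_le_of (p := b ∈ starB (cube α)) (lam := fun x => lam α x y) (hDer α) (by positivity)
      (hsupp α b y) (hVal α b.src)
  have hℓ : ∑ α, |lam α b.tgt y - lam α b.src y| ≤ ℓ := hlip b y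
  have hℓ0 : 0 ≤ ℓ := (sum_nonneg fun α _ => abs_nonneg _).trans hℓ
  have hc : |P.eps⁻¹| = P.eps⁻¹ := abs_of_pos (inv_pos.2 P.eps_pos)
  calc ‖∑ α, covD P.eps⁻¹ (cfg U) (fun x => (lam α x y : ℂ) *
          gBox (B1RG242Torus.α P a k * (P.L : ℝ) ^ (k * P.d)) P.eps⁻¹ U k (cube α) x y) b‖
      ≤ ∑ α, ‖covD P.eps⁻¹ (cfg U) (fun x => (lam α x y : ℂ) *
          gBox (B1RG242Torus.α P a k * (P.L : ℝ) ^ (k * P.d)) P.eps⁻¹ U k (cube α) x y) b‖ := norm_sum_le _ _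
    _ ≤ ∑ α, (|lam α b.tgt y| * (c₁ * P.spacing k * Real.exp (-(t₀ * (supDist y b.tgt : ℝ) / (P.L : ℝ) ^ k))) +
          |P.eps⁻¹| * |lam α b.tgt y - lam α b.src y| *
            (c₀ * P.spacing k ^ 2 * Real.exp (-(t₀ * (supDist y b.src : ℝ) / (P.L : ℝ) ^ k)))) :=
        sum_le_sum fun α _ => hterm α
    _ = (∑ α, |lam α b.tgt y|) * (c₁ * P.spacing k * Real.exp (-(t₀ * (supDist y b.tgt : ℝ) / (P.L : ℝ) ^ k))) +
          |P.eps⁻¹| * (∑ α, |lam α b.tgt y - lam α b.src y|) *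
            (c₀ * P.spacing k ^ 2 * Real.exp (-(t₀ * (supDist y b.src : ℝ) / (P.L : ℝ) ^ k))) := by
        rw [Finset.sum_add_distrib, ← Finset.sum_mul, ← Finset.sum_mul, ← Finset.mul_sum]
    _ ≤ 1 * (c₁ * P.spacing k * Real.exp (-(t₀ * (supDist y b.tgt : ℝ) / (P.L : ℝ) ^ k))) +
          |P.eps⁻¹| * ℓ * (c₀ * P.spacing k ^ 2 *
            (Real.exp 1 * Real.exp (-(t₀ * (supDist y b.tgt : ℝ) / (P.L : ℝ) ^ k)))) :=
        add_le_add (mul_le_mul_of_nonneg_right (hlam _ _) (by positivity))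
          (mul_le_mul (mul_le_mul_of_nonneg_left hℓ (abs_nonneg _)) (mul_le_mul_of_nonneg_left hEsrc (by positivity))
            (by positivity) (mul_nonneg (abs_nonneg _) hℓ0))
    _ = (c₁ * P.spacing k + Real.exp 1 * c₀ * ℓ * P.eps⁻¹ * P.spacing k ^ 2) *
          Real.exp (-(t₀ * (supDist y b.tgt : ℝ) / (P.L : ℝ) ^ k)) := by
        rw [hc]; ring

/-- **THE COVARIANT-DERIVATIVE MEMBER FOR (2.28) `G_{k,loc}(u) = ζ″_kG̃_k(u)` AT NON-FLAT SMALL FIELDS**, in KERNEL form: regions and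
weights as in `decay_covD_gTilde_smallField_kernel`, ANY real cut-off with `|ζ″| ≤ 1` smooth in the output point at the bond scale,
`|ζ″(b₊,y) − ζ″(b₋,y)| ≤ ℓ′` ((2.29): *"smooth in x₁−x₂"*): `‖(D_uG_{k,loc}(u)(·,y))(b)‖ ≤ (c₁(L^kε) + c₂(ℓ + ℓ′)ε⁻¹(L^kε)²)e^{−t₀|y−b₊|_∞/L^k}`
for every bond `b`, `t₀, c₁, c₂ > 0` depending on `(d, a)` only — the located INPUT SHAPE, at non-flat `u` and for the object with
body, of the covariant-derivative clause of the p. 263 sentence (p08's hence-step `BIJ88HolderDecay230.covDerivOpDecay230` takes it as a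
displayed hypothesis on abstract kernels). [cite: BalabanImbrieJaffe1988, (2.28) p.263] -/
theorem decay_covD_gLocT_smallField_kernel (d : ℕ) {a : ℝ} (ha : 0 < a) :
    ∃ t₀ c₁ c₂ : ℝ, 0 < t₀ ∧ 0 < c₁ ∧ 0 < c₂ ∧ ∀ (P : Params), P.d = d →
      ∀ k : ℕ, 1 ≤ k → k ≤ P.m + P.K → ∀ (ι : Type) [Fintype ι] (cube : ι → Finset (Balaban1983to89.Site P 0))
        (lam : ι → Balaban1983to89.Site P 0 → Balaban1983to89.Site P 0 → ℝ)
        (ζ'' : Balaban1983to89.Site P 0 → Balaban1983to89.Site P 0 → ℝ) (ℓ ℓ' : ℝ),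
        (∀ α, IsBlockUnion k (cube α)) → (∀ x y, ∑ α, |lam α x y| ≤ 1) →
        (∀ α (b : PBond P 0) y, b ∉ starB (cube α) → lam α b.tgt y = 0 ∧ lam α b.src y = 0) →
        (∀ (b : PBond P 0) y, ∑ α, |lam α b.tgt y - lam α b.src y| ≤ ℓ) →
        (∀ x y, |ζ'' x y| ≤ 1) → (∀ (b : PBond P 0) y, |ζ'' b.tgt y - ζ'' b.src y| ≤ ℓ') →
        ∀ (U : GaugeField P 0 U1) (T δ : ℝ),
          (∀ b : PBond P 0, blkIter k b.src = blkIter k b.tgt → ‖toC (U b) - 1‖ ≤ T) →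
          (∀ x, ‖holCK U k x - 1‖ ≤ δ) →
          2 * (((P.L : ℝ) ^ k - 1) * (P.L : ℝ) ^ k) * P.d * T ^ 2 + 2 * δ ^ 2 ≤ 1 / 2 →
          ∀ (b : PBond P 0) (y : Balaban1983to89.Site P 0),
            ‖covD P.eps⁻¹ (cfg U)
                (fun x => gLocT (B1RG242Torus.α P a k * (P.L : ℝ) ^ (k * P.d)) P.eps⁻¹ U k cube lam ζ'' x y) b‖ ≤
              (c₁ * P.spacing k + c₂ * (ℓ + ℓ') * P.eps⁻¹ * P.spacing k ^ 2) *
                Real.exp (-(t₀ * (supDist y b.tgt : ℝ) / (P.L : ℝ) ^ k)) := by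
  obtain ⟨t₁, c₁, c₂, ht₁, hc₁, hc₂, HD⟩ := decay_covD_gTilde_smallField_kernel d ha
  obtain ⟨t₃, c₃, ht₃, hc₃, HV⟩ := decay_gTilde_smallField_kernel d ha
  have ht₀pos : 0 < min 1 (min t₁ t₃) := lt_min one_pos (lt_min ht₁ ht₃)
  refine ⟨min 1 (min t₁ t₃), c₁, max c₂ (Real.exp 1 * c₃), ht₀pos, hc₁, lt_max_of_lt_left hc₂, ?_⟩
  intro P hPd k hk1 hk ι _ cube lam ζ'' ℓ ℓ' hcube hlam hsupp hlip hζ hζlip U T δ hInt hTree hsmall b y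
  obtain ⟨t₀, ht₀⟩ : ∃ t : ℝ, t = min 1 (min t₁ t₃) := ⟨_, rfl⟩
  rw [← ht₀] at ht₀pos ⊢
  have ht₀1 : t₀ ≤ 1 := ht₀ ▸ min_le_left _ _
  have ht₀t₁ : t₀ ≤ t₁ := ht₀ ▸ (min_le_right _ _).trans (min_le_left _ _)
  have ht₀t₃ : t₀ ≤ t₃ := ht₀ ▸ (min_le_right _ _).trans (min_le_right _ _)
  have hn1 : (1 : ℝ) ≤ (P.L : ℝ) ^ k := one_le_pow₀ (B1RG242Torus.one_lt_cast_L P).le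
  have hn0 : (0 : ℝ) ≤ (P.L : ℝ) ^ k := zero_le_one.trans hn1
  have hsp : 0 < P.spacing k := P.spacing_pos k
  have hε : 0 < P.eps⁻¹ := inv_pos.2 P.eps_pos
  have hℓ0 : 0 ≤ ℓ := (sum_nonneg fun α _ => abs_nonneg _).trans (hlip b y)
  have hℓ'0 : 0 ≤ ℓ' := (abs_nonneg _).trans (hζlip b y)
  -- the derivative bound for `G̃_k(u)(·,y)` and the value bound at `b₋`, at the common rate `t₀`
  have hD : ‖covD P.eps⁻¹ (cfg U)
      (fun x => gTilde (B1RG242Torus.α P a k * (P.L : ℝ) ^ (k * P.d)) P.eps⁻¹ U k cube lam x y) b‖ ≤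
        (c₁ * P.spacing k + c₂ * ℓ * P.eps⁻¹ * P.spacing k ^ 2) *
          Real.exp (-(t₀ * (supDist y b.tgt : ℝ) / (P.L : ℝ) ^ k)) :=
    (HD P hPd k hk1 hk ι cube lam ℓ hcube hlam hsupp hlip U T δ hInt hTree hsmall b y).trans
      (mul_le_mul_of_nonneg_left (exp_neg_rate_mono ht₀t₁ hn0 y b.tgt) (by positivity))
  have hV : ‖gTilde (B1RG242Torus.α P a k * (P.L : ℝ) ^ (k * P.d)) P.eps⁻¹ U k cube lam b.src y‖ ≤
      c₃ * P.spacing k ^ 2 * (Real.exp 1 * Real.exp (-(t₀ * (supDist y b.tgt : ℝ) / (P.L : ℝ) ^ k))) := by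
    have h := HV P hPd k hk1 hk ι cube lam hcube hlam U T δ hInt hTree hsmall b.src y
    rw [B3TorusRadialSums.supDist_comm b.src y] at h
    exact h.trans (mul_le_mul_of_nonneg_left ((exp_neg_rate_mono ht₀t₃ hn0 y b.src).trans
      (exp_neg_src_le_exp_one_mul ht₀pos.le ht₀1 hn1 y b)) (by positivity))
  -- the cut-off moved through `D_u`
  have hfun : (fun x => gLocT (B1RG242Torus.α P a k * (P.L : ℝ) ^ (k * P.d)) P.eps⁻¹ U k cube lam ζ'' x y) =
      fun x => ((fun x => ζ'' x y) x : ℂ) *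
        gTilde (B1RG242Torus.α P a k * (P.L : ℝ) ^ (k * P.d)) P.eps⁻¹ U k cube lam x y :=
    funext fun x => by rw [gLocT_apply]
  rw [hfun]
  refine (norm_covD_weight_mul_le hD hV).trans ?_
  have h1 : |ζ'' b.tgt y| * ((c₁ * P.spacing k + c₂ * ℓ * P.eps⁻¹ * P.spacing k ^ 2) *
      Real.exp (-(t₀ * (supDist y b.tgt : ℝ) / (P.L : ℝ) ^ k))) ≤
        1 * ((c₁ * P.spacing k + max c₂ (Real.exp 1 * c₃) * ℓ * P.eps⁻¹ * P.spacing k ^ 2) *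
          Real.exp (-(t₀ * (supDist y b.tgt : ℝ) / (P.L : ℝ) ^ k))) := by
    refine mul_le_mul (hζ _ _) (mul_le_mul_of_nonneg_right ?_ (Real.exp_pos _).le) (by positivity) zero_le_one
    have : c₂ * ℓ * P.eps⁻¹ * P.spacing k ^ 2 ≤ max c₂ (Real.exp 1 * c₃) * ℓ * P.eps⁻¹ * P.spacing k ^ 2 :=
      mul_le_mul_of_nonneg_right (mul_le_mul_of_nonneg_right (mul_le_mul_of_nonneg_right (le_max_left _ _) hℓ0) hε.le)
        (sq_nonneg _)
    linarith
  have h2 : |P.eps⁻¹| * |ζ'' b.tgt y - ζ'' b.src y| *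
      (c₃ * P.spacing k ^ 2 * (Real.exp 1 * Real.exp (-(t₀ * (supDist y b.tgt : ℝ) / (P.L : ℝ) ^ k)))) ≤
        P.eps⁻¹ * ℓ' * (max c₂ (Real.exp 1 * c₃) * P.spacing k ^ 2 *
          Real.exp (-(t₀ * (supDist y b.tgt : ℝ) / (P.L : ℝ) ^ k))) := by
    rw [abs_of_pos hε]
    refine mul_le_mul (mul_le_mul_of_nonneg_left (hζlip b y) hε.le) ?_ (by positivity) (by positivity)
    have : c₃ * P.spacing k ^ 2 * (Real.exp 1 * Real.exp (-(t₀ * (supDist y b.tgt : ℝ) / (P.L : ℝ) ^ k))) =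
        (Real.exp 1 * c₃) * P.spacing k ^ 2 * Real.exp (-(t₀ * (supDist y b.tgt : ℝ) / (P.L : ℝ) ^ k)) := by ring
    rw [this]
    exact mul_le_mul_of_nonneg_right (mul_le_mul_of_nonneg_right (le_max_right _ _) (sq_nonneg _)) (Real.exp_pos _).le
  refine (add_le_add h1 h2).trans (le_of_eq ?_)
  ring

end FamilyDeriv

end

end Literature.MathematicalPhysics.QuantumFieldTheory.BalabanImbrieJaffe1984to88.BIJ88NeumannPropagatorSmallFieldRegion
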